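import Mathlib
import Literature.Barriers.PneNP.CorrelationPolytopeXCLowerBoundGraph
import Literature.Computability.AlgebraicComplexity.NestFreeMatchingPoly
import Literature.Computability.AlgebraicComplexity.MonotoneCircuitNewtonPolytopeXC
import Literature.Algebra.Polynomial.NewtonPolytope
import Summits.ValiantsHypothesis.ValiantsHypothesis.Theses.FifoMatching
import Summits.ValiantsHypothesis.ValiantsHypothesis.Theorems.FifoMatchingNFPolytopeQueueGridCorProjection
import Summits.ValiantsHypothesis.ValiantsHypothesis.Theorems.FifoMatchingNFPolytopeQuasiPolyXCOfQueueGrid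
import Summits.ValiantsHypothesis.ValiantsHypothesis.Theorems.FifoMatchingGridCorShadowZeroOnePoints
import Summits.ValiantsHypothesis.ValiantsHypothesis.Theorems.FifoMatchingNNMonomialCofactorHard
import Literature.Combinatorics.Optimization.GridCorCliqueFace
import HarnessLib

/-! # XC-DIVISION — line `xc_division` on crux `NNLinearDegreeCofactorHard` (residual target stmt-21181
`Theses.FifoMatching.NNDivisionHard`), val-idea-7 g7–g9, LENS = dual.  rev 4.1 (= rev 3.1 + §10: the parked instance `Q(Z_mix)`
DECIDED at the route rate — ★★★ `zmixCorHard_holds : ZmixCorHard`, by the exposed-face / diagonal-shadow certificate PROP E;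
§0–§8 token-unchanged, §9 declarations token-unchanged (three §9 docstrings + this header updated in rev 4.1 to val-idea-crit-3's
11:53:42Z booking text P2/P3/P4; rev 4 → 4.1 changes NO declaration)).  rc 0, 0 sorry, 0 new facts.

REV 4 (val-idea-7 g9, one bounded pass on the LAW's instance, director R227 shape).  §10 proves `ZmixCorHard` (§9, typed by g8
as OPEN): `HasEFOfSize (COR(K_n) + Z_mix(n)) r → HasEFOfSize (COR(K_m)) r` for `m + m² ≤ n` (`hasEFOfSize_cor_of_cor_add_zmix`:
face of the sum in the AND-gadget direction, then the DIAGONAL READ, which kills the off-diagonal zonotope `Z_mix` and turns the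
gadget face of `COR(K_n)` into `COR(K_m)`), hence `2^{(⌊√n⌋−1)/2} ≤ r` (Kaibel–Weltge in the tree) `> T c n` eventually.
`ZmixCorExpHard` (rate `2^{cn}`) is NOT decided; `CorMinkowskiHard` (all passengers) is NOT decided; 21181 OPEN; VP ≠ VNP untouched.
BOOKING (val-idea-crit-3 11:53:42Z P2/P3, director R233 (a)): «Q(Z_mix) DECIDED·TRUE (route rate) by the diagonal-shadow certificate;
crit-3's "open instance" clause of 11:06:37Z withdrawn; R224 (α)'s parked instance is CLOSED, ledger unchanged (21181 open; nothing wanted by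
name)»; «no explicit open instance of COR-MINKOWSKI currently known to the line; LAW ∀Q OPEN; certificate families of record: chamber
(g1–g8, PROP A/A♯/B/D₀), diagonal shadow (g9, PROP E)».  The diagonal-shadow family reads an n-dimensional 0/1 argmax set, so it is CAPPED at
the maximal xc of such sets (`2^{Ω(√n)}` in the tree; `2^{Ω(n/log n)}` in print, Göös–Jain–Watson 2016/18, stable-set direction) — it cannot
give `ZmixCorExpHard`'s literal `2^{c·n}` without Göös–Jain–Watson's `2^{Ω(n)}` conjecture.

HONESTY: VP ≠ VNP is NOT proved or moved by anything here; stmt-21181 stays OPEN; the crux of this line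
(COR-MINKOWSKI, §6) is an OPEN polyhedral statement (booked LAW / open problem, director R218/R224, parked at the
explicit instance `Q(Z_mix)` of val-idea-crit-3, card §8).  What is kernel-checked is the COMPLETE reduction
`CorMinkowskiHard → Theses.FifoMatching.NNDivisionHard` (★★ `route_21181_of_corMinkowski'`, §8 — the transport is now a
THEOREM, `xcTransport_holds`) and the reach of ONE recognised dual structure (§1–§5c).

THESIS.  Over `ℝ≥0`, `Newt(NN_n · h) = NFP_n + Newt(h)` exactly and `xc(Newt f) ≤ 3·L₊(f)` for monotone CIRCUITS
(degree-free, `MonotoneCircuitEF.hasEFOfSize_newtonPolytope_complexity`).  Hence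
`21181 ⟸ NNMultiplesHard ⟸ XcMinkowskiHard (NFP_n + Newt h is xc-hard) ⟸[XcTransport ✓ §7–§8] CorMinkowskiHard ⟸ CorMinkowskiExpHard`
— every arrow PROVED here (`route_21181_of_xcMinkowski`, `xcTransport_holds` = K1's located face A1
`GridCorShadow.queueGridZeroOnePoints_holds` + c1's `QueueGridFace.corMap_image_queueGridPP` + AFHMS's clique face
`AboulkerEtAl2019_gridCorCliqueFace` carried WITH an arbitrary Newton-polytope passenger by faces/images of Minkowski
sums, + the threshold arithmetic `T_pow_four_le`; `corMinkowskiHard_of_exp`); the ONLY open input is `CorMinkowskiHard`.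
(The generic face/image-through-a-sum calculus of §2/§7 is also in the tree since 10:57Z as val-lit-p10's
`Literature/Barriers/PneNP/ExtendedFormulationMinkowskiFaces.lean` — `HasEFOfSize.face_add_face₁`,
`image_face_add_image_face`, `exists_coordFace_newtonPolytope_add_newtonPolytope_comp` («the K1-shaped plug»); a porter
rebases §7 on those names.)

THE RECOGNISED DUAL STRUCTURE (LENS dual) = the CHAMBER CERTIFICATE (§1): rows = FMPTW clique inequalities of `COR`
lifted by the passenger's support function, `⟨2diag(𝟙_a) - 𝟙_a𝟙_aᵀ, x⟩ + ⟨c_a, y⟩ ≤ 1 + h_Q(c_a)`; columns =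
`𝟙_b𝟙_bᵀ + q_j` over a HITTING family `{q_j} ⊆ Q` (every row maximised at some `q_j`); slack =
`(1 - |a ∩ b|)² + gap_a(j)` with `gap ≥ 0` and `= 0` on the chamber of `j` — an exact unique-disjointness block per
chamber, uniformly in `Q`.  Reach (all PROVED, §4–§5c), for every polytope `Q` and every size-`r` EF of `COR(n)+Q`:
* PROP A   `corPolytope_add_three_pow_le`: `Q = conv` of `K` points ⇒ `3ⁿ ≤ K (r+1) 2ⁿ`;
* PROP A♯  `corPolytope_add_three_pow_le_of_common` / `_of_dominant` / `_diagNonpos_`: a common maximiser of the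
  clique rows (every axis-parallel BOX, diagonal or off-diagonal, every sign-dominant `Q`, p11's `Q□`) ⇒ `3ⁿ ≤ (r+1) 2ⁿ`;
* PROP B   `corPolytope_add_face_three_pow_le'`: every `E_S - E_{S'}` face of `Q` has `≥ 1.5^{n-|S|-|S'|}/(r+1)`
  of the generators (`mem_convexHull_maximisers` + faces of sums `hasEFOfSize_face_add`);
* PROP D₀  `corPolytope_succ_add_diag_three_pow_le`: `Q ⊆ y₀ + diagonal matrices` (any shape) ⇒ `3^m ≤ (r+1) 2^m`
  for `COR(m+1)` — by the ANCHORED clique rows, a second certificate family indexed by COR's combinatorics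
  (answers the critic's SUB-QUESTION 1: the diagonal-free projection of `COR` is xc-hard).
LOCATED GAP: a counterexample to COR-MINKOWSKI must be non-generic with exponentially many vertices (A), have no
sign-dominant point (A♯), be vertex-rich on every coordinate-diagonal face (B), and have genuine off-diagonal,
mixed-sign extent (D₀); no polytope of extension complexity `2^{o(n)}` with these properties is known (card §8). -/

noncomputable section

set_option linter.dupNamespace false

namespace Summit.ValiantsHypothesis.ValiantsHypothesis.Cruxes.NNLinearDegreeCofactorHard.XcDivision

open Matrix Finset MvPolynomial
open scoped NNReal Pointwise
open Literature.Barriers.PneNP (HasEFOfSize three_pow_le_card_mul_two_pow_of_cover_univ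
  hasEFOfSize_corPolytopeGraph_top_iff corPolytope_eq_image_corPolytopeGraph_top)
open Literature.Combinatorics.Optimization (corPolytopeGraph)
open Literature.Combinatorics.Optimization.FixedSizePsdRank (Cube vecOuter bvec corPolytope flat
  flat_dotProduct_vecOuter flat_dotProduct_le_of_mem_corPolytope)

/-! ## §0 Elementary helpers -/

/-- validity on a generating set passes to its convex hull. [folklore] -/
theorem dot_le_of_mem_convexHull {ι : Type} [Fintype ι] (S : Set (ι → ℝ)) (u : ι → ℝ) (δ : ℝ)
    (h : ∀ x ∈ S, u ⬝ᵥ x ≤ δ) : ∀ x ∈ convexHull ℝ S, u ⬝ᵥ x ≤ δ := by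
  have hconv : Convex ℝ {x : ι → ℝ | u ⬝ᵥ x ≤ δ} :=
    convex_halfSpace_le ⟨fun x y => dotProduct_add u x y, fun c x => by
      rw [dotProduct_smul, smul_eq_mul]⟩ δ
  exact fun x hx => (convexHull_min (fun x hx => (h x hx : x ∈ {x : ι → ℝ | u ⬝ᵥ x ≤ δ})) hconv) hx

/-- `⟨2 diag(u) - uuᵀ, x xᵀ⟩ = 2 Σ u_i x_i² - (Σ u_i x_i)²`. [cite: FioriniEtAl2015, §4.1 eq. (4)] -/
theorem quad_two_diag_sub_outer {n : ℕ} (u x : Fin n → ℝ) :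
    ∑ i, ∑ j, (2 * (if i = j then 1 else 0) * u i - u i * u j) * (x i * x j) =
      2 * (∑ i, u i * (x i * x i)) - (∑ i, u i * x i) ^ 2 := by
  simp only [sub_mul, Finset.sum_sub_distrib]
  congr 1
  · rw [Finset.mul_sum]
    refine Finset.sum_congr rfl fun i _ => ?_
    rw [Finset.sum_eq_single i]
    · simp; ring
    · intro j _ hji; simp [Ne.symm hji]
    · intro h; exact absurd (Finset.mem_univ i) h
  · rw [sq, Finset.sum_mul_sum]
    refine Finset.sum_congr rfl fun i _ => Finset.sum_congr rfl fun j _ => ?_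
    ring

theorem bvec_decide_apply {n : ℕ} (a : Finset (Fin n)) (i : Fin n) :
    bvec (fun i => decide (i ∈ a)) i = if i ∈ a then 1 else 0 := by
  by_cases h : i ∈ a <;> simp [bvec, h]

/-! ## §1 The chamber pigeonhole: unique-disjointness data on `P` survive a Minkowski passenger `Q` at the
price of the number of generators of `Q` -/

/-- **Chamber pigeonhole, hitting form** (the Q-uniform certificate).  `P + Q` has an extended formulation of
size `r`; `P` carries unique-disjointness data (points `v b ∈ P`, valid rows `c a · x ≤ d a` whose slack at `v b`
is positive when `a ∩ b = ∅` and zero when `|a ∩ b| = 1`); and `q : J → Q` is a HITTING FAMILY: every row functional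
`c a` attains its maximum over `Q` at some `q j`.  Then `3^{|α|} ≤ |J| · (r + 1) · 2^{|α|}`.  Proof: lift row `a` to
`P + Q` with right-hand side `d a + max_Q c a`; on the columns `v b + q j(a)` the passenger's gap vanishes and the slack
is the UDISJ slack; refine Yannakakis' rectangles by the chamber `j(a)` and count disjoint pairs
(`three_pow_le_card_mul_two_pow_of_cover_univ`). -/
theorem three_pow_le_of_hits {ι α J : Type} [Fintype ι] [Fintype α] [DecidableEq α] [Fintype J]
    {r : ℕ} {P Q : Set (ι → ℝ)} (h : HasEFOfSize (P + Q) r)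
    (v : Finset α → ι → ℝ) (hv : ∀ b, v b ∈ P)
    (c : Finset α → ι → ℝ) (d : Finset α → ℝ) (hvalid : ∀ a, ∀ x ∈ P, c a ⬝ᵥ x ≤ d a)
    (hone : ∀ a b, c a ⬝ᵥ v b < d a → (a ∩ b).card ≠ 1)
    (hdisj : ∀ a b, Disjoint a b → c a ⬝ᵥ v b < d a)
    (q : J → ι → ℝ) (hq : ∀ j, q j ∈ Q) (hhit : ∀ a, ∃ j, ∀ y ∈ Q, c a ⬝ᵥ y ≤ c a ⬝ᵥ q j) :
    3 ^ Fintype.card α ≤ Fintype.card J * (r + 1) * 2 ^ Fintype.card α := by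
  classical
  choose jm hsQ using hhit
  -- columns `(b, j) ↦ v b + q j ∈ P + Q`, rows `a` with right-hand side `d a + c a · q (jm a)`
  let v' : Finset α × J → ι → ℝ := fun bj => v bj.1 + q bj.2
  have hv' : ∀ bj, v' bj ∈ P + Q := fun bj => Set.add_mem_add (hv bj.1) (hq bj.2)
  have hvalid' : ∀ a, ∀ z ∈ P + Q, c a ⬝ᵥ z ≤ d a + c a ⬝ᵥ q (jm a) := by
    intro a z hz
    obtain ⟨x, hx, y, hy, rfl⟩ := Set.mem_add.1 hz
    rw [dotProduct_add]
    exact add_le_add (hvalid a x hx) (hsQ a y hy)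
  obtain ⟨RA, RB, hin, hcov⟩ := h.exists_cover_option v' hv' c (fun a => d a + c a ⬝ᵥ q (jm a)) hvalid'
  -- refine Yannakakis' rectangles by the chamber of the row
  have key := three_pow_le_card_mul_two_pow_of_cover_univ (α := α)
    (Finset.univ : Finset (J × Option (Fin r)))
    (fun ji => {a | a ∈ RA ji.2 ∧ jm a = ji.1}) (fun ji => {b | (b, ji.1) ∈ RB ji.2})
    (fun ji _ a ha b hb => by
      have hlt := hin ji.2 a ha.1 (b, ji.1) hb
      have hsplit : c a ⬝ᵥ v' (b, ji.1) = c a ⬝ᵥ v b + c a ⬝ᵥ q ji.1 := dotProduct_add _ _ _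
      rw [hsplit] at hlt
      have hj : c a ⬝ᵥ q ji.1 = c a ⬝ᵥ q (jm a) := by rw [ha.2]
      exact hone a b (by linarith))
    (fun a b hab => by
      have hlt : c a ⬝ᵥ v' (b, jm a) < d a + c a ⬝ᵥ q (jm a) := by
        show c a ⬝ᵥ (v b + q (jm a)) < _
        rw [dotProduct_add]
        linarith [hdisj a b hab]
      obtain ⟨i, ha, hb⟩ := hcov a (b, jm a) hlt
      exact ⟨(jm a, i), Finset.mem_univ _, ⟨ha, rfl⟩, hb⟩)
  rw [Finset.card_univ, Fintype.card_prod, Fintype.card_option, Fintype.card_fin] at key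
  exact key

/-- **Chamber pigeonhole, vertex form**: if `Q ⊆ conv{q j}` with all `q j ∈ Q` then `{q j}` is a hitting family
(a linear functional on a polytope is maximised at a generator), so `3^{|α|} ≤ |J| · (r + 1) · 2^{|α|}`. -/
theorem three_pow_le_of_add {ι α J : Type} [Fintype ι] [Fintype α] [DecidableEq α] [Fintype J]
    [Nonempty J] {r : ℕ} {P Q : Set (ι → ℝ)} (h : HasEFOfSize (P + Q) r)
    (v : Finset α → ι → ℝ) (hv : ∀ b, v b ∈ P)
    (c : Finset α → ι → ℝ) (d : Finset α → ℝ) (hvalid : ∀ a, ∀ x ∈ P, c a ⬝ᵥ x ≤ d a)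
    (hone : ∀ a b, c a ⬝ᵥ v b < d a → (a ∩ b).card ≠ 1)
    (hdisj : ∀ a b, Disjoint a b → c a ⬝ᵥ v b < d a)
    (q : J → ι → ℝ) (hq : ∀ j, q j ∈ Q) (hQ : Q ⊆ convexHull ℝ (Set.range q)) :
    3 ^ Fintype.card α ≤ Fintype.card J * (r + 1) * 2 ^ Fintype.card α := by
  classical
  refine three_pow_le_of_hits h v hv c d hvalid hone hdisj q hq fun a => ?_
  obtain ⟨j, -, hj⟩ :=
    Finset.exists_max_image Finset.univ (fun j => c a ⬝ᵥ q j) Finset.univ_nonempty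
  exact ⟨j, fun y hy => dot_le_of_mem_convexHull _ (c a) _
    (by rintro _ ⟨j', rfl⟩; exact hj j' (Finset.mem_univ _)) y (hQ hy)⟩

/-! ## §2 Faces of Minkowski sums -/

/-- **Faces distribute over Minkowski sums**: if `w · x ≤ δP` on `P` and `w · y ≤ δQ` on `Q`, the face of `P + Q`
in direction `w` is the sum of the two faces. [folklore; e.g. Schneider, *Convex bodies*, Thm. 1.7.5(c)] -/
theorem inter_add_eq_add_inter {ι : Type} [Fintype ι] (P Q : Set (ι → ℝ)) (w : ι → ℝ) (δP δQ : ℝ)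
    (hP : ∀ x ∈ P, w ⬝ᵥ x ≤ δP) (hQ : ∀ y ∈ Q, w ⬝ᵥ y ≤ δQ) :
    (P + Q) ∩ {z | w ⬝ᵥ z = δP + δQ} = (P ∩ {x | w ⬝ᵥ x = δP}) + (Q ∩ {y | w ⬝ᵥ y = δQ}) := by
  ext z
  constructor
  · rintro ⟨hz, hzw⟩
    obtain ⟨x, hx, y, hy, rfl⟩ := Set.mem_add.1 hz
    have hzw' : w ⬝ᵥ x + w ⬝ᵥ y = δP + δQ := by rw [← dotProduct_add]; exact hzw
    have h1 := hP x hx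
    have h2 := hQ y hy
    exact Set.add_mem_add ⟨hx, by show w ⬝ᵥ x = δP; linarith⟩ ⟨hy, by show w ⬝ᵥ y = δQ; linarith⟩
  · intro hz
    obtain ⟨x, ⟨hx, hxw⟩, y, ⟨hy, hyw⟩, rfl⟩ := Set.mem_add.1 hz
    refine ⟨Set.add_mem_add hx hy, ?_⟩
    show w ⬝ᵥ (x + y) = δP + δQ
    rw [dotProduct_add, hxw, hyw]

/-- Hence an extended formulation of `P + Q` is one of `F_w(P) + F_w(Q)` of the same size (`HasEFOfSize.inter_eqs`). -/
theorem hasEFOfSize_face_add {ι : Type} [Fintype ι] {P Q : Set (ι → ℝ)} {r : ℕ} (h : HasEFOfSize (P + Q) r)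
    (w : ι → ℝ) (δP δQ : ℝ) (hP : ∀ x ∈ P, w ⬝ᵥ x ≤ δP) (hQ : ∀ y ∈ Q, w ⬝ᵥ y ≤ δQ) :
    HasEFOfSize ((P ∩ {x | w ⬝ᵥ x = δP}) + (Q ∩ {y | w ⬝ᵥ y = δQ})) r := by
  have h1 := h.inter_eqs (T := Unit) (fun _ => w) (fun _ => δP + δQ)
  rw [show (P + Q) ∩ {z | ∀ _ : Unit, w ⬝ᵥ z = δP + δQ} = (P + Q) ∩ {z | w ⬝ᵥ z = δP + δQ} by
    ext z; simp, inter_add_eq_add_inter P Q w δP δQ hP hQ] at h1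
  exact h1

/-- Linear images distribute over Minkowski sums, keeping the size (`HasEFOfSize.image_linearMap`). -/
theorem hasEFOfSize_image_add {ι κ : Type} [Fintype ι] [Fintype κ] {P Q : Set (ι → ℝ)} {r : ℕ}
    (h : HasEFOfSize (P + Q) r) (L : (ι → ℝ) →ₗ[ℝ] (κ → ℝ)) : HasEFOfSize (L '' P + L '' Q) r := by
  rw [← Set.image_add]; exact h.image_linearMap L

/-! ## §3 The unique-disjointness data of `COR(n)` (FMPTW Lemma 6, as in `corPolytope_three_pow_le`) -/

/-- `Σ_i Σ_j diag(σ)_{ij} x_i x_j = Σ_i σ_i x_i²`. [folklore] -/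
theorem diag_quad {n : ℕ} (σ x : Fin n → ℝ) :
    ∑ i, ∑ j, Matrix.diagonal σ i j * (x i * x j) = ∑ i, σ i * (x i * x i) := by
  refine Finset.sum_congr rfl fun i _ => ?_
  rw [Finset.sum_eq_single i]
  · rw [Matrix.diagonal_apply_eq]
  · intro j _ hji; rw [Matrix.diagonal_apply_ne _ (Ne.symm hji), zero_mul]
  · intro hi; exact absurd (Finset.mem_univ i) hi

/-- diagonal directions are valid on `COR(n)` with right-hand side `Σ_i max(σ_i, 0)`. [cite: FioriniEtAl2015, Lemma 6] -/
theorem diag_valid (n : ℕ) (σ : Fin n → ℝ) :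
    ∀ x ∈ corPolytope n, flat (Matrix.diagonal σ) ⬝ᵥ x ≤ ∑ i, max (σ i) 0 := by
  intro y hy
  refine flat_dotProduct_le_of_mem_corPolytope hy ⟨(Matrix.diagonal σ, ∑ i, max (σ i) 0), fun x hx => ?_⟩
  show ∑ i, ∑ j, Matrix.diagonal σ i j * (x i * x j) ≤ ∑ i, max (σ i) 0
  rw [diag_quad]
  refine Finset.sum_le_sum fun i _ => ?_
  rcases hx i with h | h
  · rw [h, mul_zero, mul_zero]; exact le_max_right _ _
  · rw [h, mul_one, mul_one]; exact le_max_left _ _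

/-- `⟨c, d⟩ = Σ_{ij} c_{ij} d_{ij}` for flattened matrices. [folklore] -/
theorem flat_dotProduct_flat {n : ℕ} (c d : Matrix (Fin n) (Fin n) ℝ) :
    flat c ⬝ᵥ flat d = ∑ i, ∑ j, c i j * d i j := by
  unfold flat dotProduct
  rw [← finProdFinEquiv.sum_comp]
  simp only [Equiv.symm_apply_apply]
  rw [Fintype.sum_prod_type]

/-- indicator vector `𝟙_a` of a subset (as `bvec`) -/
def udInd {n : ℕ} (a : Finset (Fin n)) : Fin n → ℝ := bvec fun i => decide (i ∈ a)

/-- the vertex `𝟙_b 𝟙_bᵀ` of `COR(n)` -/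
def udPt {n : ℕ} (b : Finset (Fin n)) : Fin (n * n) → ℝ := vecOuter n (udInd b)

/-- the FMPTW / clique matrix `2 diag(𝟙_a) - 𝟙_a 𝟙_aᵀ` -/
def udMat {n : ℕ} (a : Finset (Fin n)) : Matrix (Fin n) (Fin n) ℝ := fun i j =>
  2 * (if i = j then 1 else 0) * udInd a i - udInd a i * udInd a j

/-- the FMPTW row functional `x ↦ ⟨2 diag(𝟙_a) - 𝟙_a 𝟙_aᵀ, x⟩` (valid: `≤ 1` on `COR(n)`) -/
def udRow {n : ℕ} (a : Finset (Fin n)) : Fin (n * n) → ℝ := flat (udMat a)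

theorem udInd_apply {n : ℕ} (a : Finset (Fin n)) (i : Fin n) :
    udInd a i = if i ∈ a then 1 else 0 := bvec_decide_apply a i

theorem udInd_sq {n : ℕ} (a : Finset (Fin n)) (i : Fin n) : udInd a i * udInd a i = udInd a i := by
  rw [udInd_apply]; by_cases hi : i ∈ a <;> simp [hi]

theorem udInd_inter {n : ℕ} (a b : Finset (Fin n)) : ∑ i, udInd a i * udInd b i = ((a ∩ b).card : ℝ) := by
  classical
  have : ∀ i, udInd a i * udInd b i = if i ∈ a ∩ b then 1 else 0 := fun i => by
    rw [udInd_apply, udInd_apply]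
    by_cases ha : i ∈ a <;> by_cases hb : i ∈ b <;> simp [ha, hb]
  simp only [this]
  rw [Finset.sum_boole, Finset.filter_mem_eq_inter, Finset.univ_inter]

/-- **The FMPTW data of `COR(n)`, explicit**: `udPt b ∈ COR(n)`; `udRow a ≤ 1` is valid on `COR(n)`; its slack
at `udPt b` is `(1 - |a ∩ b|)²`; diagonal functionals evaluate to `Σ_{i∈b} σ_i` at `udPt b`; and `udRow a`
evaluates to `Σ_{i∈a} σ_i` on the diagonal matrix `diag σ`. [cite: FioriniEtAl2015, §4.1 eq. (4), Lemma 6] -/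
theorem ud_data (n : ℕ) :
    (∀ b : Finset (Fin n), udPt b ∈ corPolytope n) ∧
      (∀ a : Finset (Fin n), ∀ x ∈ corPolytope n, udRow a ⬝ᵥ x ≤ 1) ∧
      (∀ a b : Finset (Fin n), 1 - udRow a ⬝ᵥ udPt b = (1 - ((a ∩ b).card : ℝ)) ^ 2) ∧
      (∀ (σ : Fin n → ℝ) (b : Finset (Fin n)), flat (Matrix.diagonal σ) ⬝ᵥ udPt b = ∑ i ∈ b, σ i) := by
  classical
  have pt_mem : ∀ b : Finset (Fin n), udPt b ∈ corPolytope n := fun b =>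
    subset_convexHull ℝ _ ⟨fun i => decide (i ∈ b), rfl⟩
  have valid01 : ∀ (a : Finset (Fin n)) (x : Fin n → ℝ), (∀ i, x i = 0 ∨ x i = 1) →
      ∑ i, ∑ j, udMat a i j * (x i * x j) ≤ 1 := by
    intro a x hx
    show ∑ i, ∑ j, (2 * (if i = j then 1 else 0) * udInd a i - udInd a i * udInd a j) * (x i * x j) ≤ 1
    rw [quad_two_diag_sub_outer]
    have hsq : ∀ i, x i * x i = x i := fun i => by rcases hx i with h | h <;> simp [h]
    simp only [hsq]
    nlinarith [sq_nonneg (∑ i, udInd a i * x i - 1)]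
  have slack : ∀ a b : Finset (Fin n), 1 - udRow a ⬝ᵥ udPt b = (1 - ((a ∩ b).card : ℝ)) ^ 2 := by
    intro a b
    show 1 - flat (udMat a) ⬝ᵥ vecOuter n (udInd b) = _
    rw [flat_dotProduct_vecOuter]
    show 1 - ∑ i, ∑ j, (2 * (if i = j then 1 else 0) * udInd a i - udInd a i * udInd a j) *
      (udInd b i * udInd b j) = _
    rw [quad_two_diag_sub_outer]
    simp only [udInd_sq, udInd_inter]
    ring
  refine ⟨pt_mem, ?_, slack, ?_⟩
  · intro a y hy
    exact flat_dotProduct_le_of_mem_corPolytope hy ⟨(udMat a, 1), fun x hx => valid01 a x hx⟩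
  · intro σ b
    show flat (Matrix.diagonal σ) ⬝ᵥ vecOuter n (udInd b) = _
    rw [flat_dotProduct_vecOuter, diag_quad]
    simp only [udInd_apply, mul_ite, mul_one, mul_zero]
    rw [Finset.sum_ite_mem, Finset.univ_inter]
    exact Finset.sum_congr rfl fun i hi => if_pos hi

/-- `⟨udRow a, diag σ⟩ = Σ_{i ∈ a} σ_i`: the clique rows see a diagonal passenger only through `Σ_{i∈a}`. -/
theorem udRow_dotProduct_flat_diagonal {n : ℕ} (a : Finset (Fin n)) (σ : Fin n → ℝ) :
    udRow a ⬝ᵥ flat (Matrix.diagonal σ) = ∑ i ∈ a, σ i := by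
  classical
  rw [udRow, flat_dotProduct_flat]
  have : ∀ i : Fin n, ∑ j, udMat a i j * Matrix.diagonal σ i j = udInd a i * σ i := by
    intro i
    rw [Finset.sum_eq_single i]
    · show (2 * (if i = i then 1 else 0) * udInd a i - udInd a i * udInd a i) * Matrix.diagonal σ i i = _
      rw [Matrix.diagonal_apply_eq, if_pos rfl, udInd_sq]; ring
    · intro j _ hji; rw [Matrix.diagonal_apply_ne _ (Ne.symm hji), mul_zero]
    · intro hi; exact absurd (Finset.mem_univ i) hi
  simp only [this, udInd_apply, ite_mul, one_mul, zero_mul]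
  rw [Finset.sum_ite_mem, Finset.univ_inter]

/-- existential packaging of `ud_data` (used by PROP A/B). -/
theorem cor_udisj_data (n : ℕ) :
    ∃ (pt cc : Finset (Fin n) → Fin (n * n) → ℝ),
      (∀ b, pt b ∈ corPolytope n) ∧ (∀ a, ∀ x ∈ corPolytope n, cc a ⬝ᵥ x ≤ 1) ∧
      (∀ a b, 1 - cc a ⬝ᵥ pt b = (1 - ((a ∩ b).card : ℝ)) ^ 2) ∧
      (∀ (σ : Fin n → ℝ) (b : Finset (Fin n)), flat (Matrix.diagonal σ) ⬝ᵥ pt b = ∑ i ∈ b, σ i) :=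
  ⟨udPt, udRow, (ud_data n).1, (ud_data n).2.1, (ud_data n).2.2.1, (ud_data n).2.2.2⟩

/-! ## §4 PROP A: `xc(COR(n) + Q) ≥ 1.5ⁿ / #vert(Q) - 1` -/

/-- **PROP A (counting form).**  If `COR(n) + Q` has an extended formulation of size `r` and `Q` lies in the
convex hull of `K ≥ 1` of its points, then `3ⁿ ≤ K · (r + 1) · 2ⁿ`: a Minkowski passenger with few vertices
cannot destroy the Fiorini–Massar–Pokutta–Tiwary–de Wolf / Kaibel–Weltge bound.  (`K = 1`, `Q` a point:
`corPolytope_three_pow_le`.) -/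
theorem corPolytope_add_three_pow_le {n r K : ℕ} {Q : Set (Fin (n * n) → ℝ)}
    (h : HasEFOfSize (corPolytope n + Q) r) (q : Fin K → (Fin (n * n) → ℝ)) (hK : 0 < K)
    (hq : ∀ j, q j ∈ Q) (hQ : Q ⊆ convexHull ℝ (Set.range q)) :
    3 ^ n ≤ K * (r + 1) * 2 ^ n := by
  classical
  obtain ⟨pt, cc, pt_mem, cc_valid, slack, -⟩ := cor_udisj_data n
  haveI : Nonempty (Fin K) := Fin.pos_iff_nonempty.1 hK
  have key := three_pow_le_of_add h pt pt_mem cc (fun _ => 1) cc_valid ?_ ?_ q hq hQ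
  · simpa [Fintype.card_fin] using key
  · intro a b hlt hone
    have := slack a b
    rw [hone] at this
    norm_num at this
    linarith
  · intro a b hab
    have := slack a b
    rw [Finset.disjoint_iff_inter_eq_empty.1 hab, Finset.card_empty] at this
    norm_num at this
    linarith

/-- **PROP A (exponential form)**: `(3/2)ⁿ ≤ K · (r + 1)` — every polytope `Q` with at most `K` vertices has
`xc(COR(n) + Q) ≥ 1.5ⁿ / K - 1`. -/
theorem corPolytope_add_xc_ge {n r K : ℕ} {Q : Set (Fin (n * n) → ℝ)}
    (h : HasEFOfSize (corPolytope n + Q) r) (q : Fin K → (Fin (n * n) → ℝ)) (hK : 0 < K)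
    (hq : ∀ j, q j ∈ Q) (hQ : Q ⊆ convexHull ℝ (Set.range q)) :
    (3 / 2 : ℝ) ^ n ≤ K * (r + 1) := by
  have h3 := corPolytope_add_three_pow_le h q hK hq hQ
  have h2 : (0 : ℝ) < 2 ^ n := by positivity
  rw [div_pow, div_le_iff₀ h2]
  exact_mod_cast h3

/-- PROP A for `Q = conv{q j}` itself. -/
theorem corPolytope_add_hull_three_pow_le {n r K : ℕ} (q : Fin K → (Fin (n * n) → ℝ)) (hK : 0 < K)
    (h : HasEFOfSize (corPolytope n + convexHull ℝ (Set.range q)) r) :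
    3 ^ n ≤ K * (r + 1) * 2 ^ n :=
  corPolytope_add_three_pow_le h q hK (fun j => subset_convexHull ℝ _ ⟨j, rfl⟩) subset_rfl

/-- **PROP A in the graph currency `COR(K_h) = corPolytopeGraph ⊤`** (the currency in which the route's located
face of `NFP_n` lands, `AboulkerEtAl2019_gridCorCliqueFace`): `3^h ≤ K · (r + 1) · 2^h` for every extended
formulation of size `r` of `COR(K_h) + conv{q_1, …, q_K}`. -/
theorem corPolytopeGraph_top_add_hull_three_pow_le {h r K : ℕ} (q : Fin K → (Fin h × Fin h → ℝ))
    (hK : 0 < K)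
    (hyp : HasEFOfSize (corPolytopeGraph (⊤ : SimpleGraph (Fin h)) + convexHull ℝ (Set.range q)) r) :
    3 ^ h ≤ K * (r + 1) * 2 ^ h := by
  let e : (Fin h × Fin h → ℝ) ≃ₗ[ℝ] (Fin (h * h) → ℝ) :=
    LinearEquiv.funCongrLeft ℝ ℝ (finProdFinEquiv (m := h) (n := h)).symm
  have himg : e '' (corPolytopeGraph (⊤ : SimpleGraph (Fin h)) + convexHull ℝ (Set.range q)) =
      corPolytope h + convexHull ℝ (Set.range (e ∘ q)) := by
    rw [Set.image_add, corPolytope_eq_image_corPolytopeGraph_top, Set.range_comp]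
    congr 1
    exact e.toLinearMap.image_convexHull (Set.range q)
  have h' : HasEFOfSize (corPolytope h + convexHull ℝ (Set.range (e ∘ q))) r := by
    rw [← himg]; exact (HasEFOfSize.image_linearEquiv_iff e).2 hyp
  exact corPolytope_add_hull_three_pow_le (e ∘ q) hK h'

/-! ## §5 PROP B: the faces of a counterexample are pinned — `#vert F_{E_S - E_{S'}}(Q) · (r + 1) ≥ 1.5^{n-|S|-|S'|}` -/

/-- **A face of `conv{q j}` lies in the hull of the maximising generators.** [folklore] -/
theorem mem_convexHull_maximisers {ι J : Type} [Fintype ι] (q : J → ι → ℝ) (w : ι → ℝ) (δ : ℝ)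
    (hle : ∀ j, w ⬝ᵥ q j ≤ δ) {y : ι → ℝ} (hy : y ∈ convexHull ℝ (Set.range q)) (hyw : w ⬝ᵥ y = δ) :
    y ∈ convexHull ℝ (Set.range fun j : {j : J // w ⬝ᵥ q j = δ} => q j.1) := by
  classical
  rw [convexHull_range_eq_exists_affineCombination] at hy
  obtain ⟨s, μ, hμ0, hμ1, rfl⟩ := hy
  rw [Finset.affineCombination_eq_linear_combination s q μ hμ1] at hyw ⊢
  let wL : (ι → ℝ) →ₗ[ℝ] ℝ :=
    { toFun := fun x => w ⬝ᵥ x, map_add' := fun x y => dotProduct_add w x y,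
      map_smul' := fun a x => by simp [dotProduct_smul] }
  have hsum : ∑ i ∈ s, μ i * (w ⬝ᵥ q i) = δ := by
    have : wL (∑ i ∈ s, μ i • q i) = ∑ i ∈ s, μ i * (w ⬝ᵥ q i) := by
      rw [map_sum]
      refine Finset.sum_congr rfl fun i _ => ?_
      rw [map_smul]; rfl
    rw [← this]; exact hyw
  have hzero : ∀ i ∈ s, μ i * (δ - w ⬝ᵥ q i) = 0 := by
    have h0 : ∑ i ∈ s, μ i * (δ - w ⬝ᵥ q i) = 0 := by
      simp only [mul_sub, Finset.sum_sub_distrib, ← Finset.sum_mul, hμ1, one_mul, hsum, sub_self]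
    exact (Finset.sum_eq_zero_iff_of_nonneg fun i hi =>
      mul_nonneg (hμ0 i hi) (sub_nonneg.2 (hle i))).1 h0
  rw [← Finset.centerMass_eq_of_sum_1 _ _ hμ1, ← Finset.centerMass_filter_ne_zero]
  refine Finset.centerMass_mem_convexHull _ (fun i hi => hμ0 i (Finset.mem_filter.1 hi).1) ?_ ?_
  · rw [Finset.sum_filter_ne_zero, hμ1]; exact one_pos
  · intro i hi
    obtain ⟨his, hne⟩ := Finset.mem_filter.1 hi
    have hwi : w ⬝ᵥ q i = δ := by
      rcases mul_eq_zero.1 (hzero i his) with h0 | h0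
      · exact absurd h0 hne
      · linarith
    exact ⟨⟨i, hwi⟩, rfl⟩

/-- the signed diagonal direction `E_S - E_{S'}` of `ℝ^{n×n}` (flattened): it exposes the face
`{bbᵀ : S ⊆ b, b ∩ S' = ∅} ≅ COR(n - |S| - |S'|)` of `COR(n)`. -/
def diagDir {n : ℕ} (S S' : Finset (Fin n)) : Fin (n * n) → ℝ :=
  flat (Matrix.diagonal fun i => if i ∈ S then (1 : ℝ) else if i ∈ S' then -1 else 0)

/-- **PROP B (embedding form).**  If `COR(n) + Q` has an extended formulation of size `r`, `Q ⊆ conv{q j}` with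
`q j ∈ Q`, and `S, S'` are disjoint with `m` indices outside `S ∪ S'`, then the number of generators `q j`
MAXIMISING the direction `E_S - E_{S'}` is at least `1.5^m / (r + 1)`: the face of the sum in that direction is
`F_{S,S'}(COR(n)) + F(Q)` (`hasEFOfSize_face_add`), the first summand carries the unique-disjointness data of
`COR(m)`, the second is spanned by the maximisers (`mem_convexHull_maximisers`), and the chamber pigeonhole
applies.  In particular a GENERIC `Q` (every `E_S - E_{S'}` maximised by one vertex) has
`xc(COR(n) + Q) ≥ 1.5^{n-1} - 1`. -/
theorem corPolytope_add_face_three_pow_le {n m r : ℕ} {Q : Set (Fin (n * n) → ℝ)}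
    (h : HasEFOfSize (corPolytope n + Q) r) {J : Type} [Fintype J] [Nonempty J]
    (q : J → (Fin (n * n) → ℝ)) (hq : ∀ j, q j ∈ Q) (hQ : Q ⊆ convexHull ℝ (Set.range q))
    (S S' : Finset (Fin n)) (e : Fin m ↪ Fin n) (heS : ∀ i, e i ∉ S) (heS' : ∀ i, e i ∉ S') :
    ∃ j₀ : J, (∀ j, diagDir S S' ⬝ᵥ q j ≤ diagDir S S' ⬝ᵥ q j₀) ∧
      3 ^ m ≤ Fintype.card {j : J // diagDir S S' ⬝ᵥ q j = diagDir S S' ⬝ᵥ q j₀} * (r + 1) * 2 ^ m := by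
  classical
  obtain ⟨pt, cc, pt_mem, cc_valid, slack, diag_pt⟩ := cor_udisj_data n
  obtain ⟨j₀, -, hj₀⟩ :=
    Finset.exists_max_image Finset.univ (fun j => diagDir S S' ⬝ᵥ q j) Finset.univ_nonempty
  have hmax : ∀ j, diagDir S S' ⬝ᵥ q j ≤ diagDir S S' ⬝ᵥ q j₀ := fun j => hj₀ j (Finset.mem_univ j)
  refine ⟨j₀, hmax, ?_⟩
  set w := diagDir S S' with hw
  set δQ := w ⬝ᵥ q j₀ with hδQ
  -- validity of `w` on `COR(n)` (rhs `|S|`) and on `Q` (rhs `δQ`)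
  have hσmax : ∑ i : Fin n, max (if i ∈ S then (1 : ℝ) else if i ∈ S' then -1 else 0) 0 = S.card := by
    have : ∀ i : Fin n, max (if i ∈ S then (1 : ℝ) else if i ∈ S' then -1 else 0) 0 =
        if i ∈ S then 1 else 0 := by
      intro i; by_cases hi : i ∈ S <;> by_cases hi' : i ∈ S' <;> simp [hi, hi']
    simp only [this]
    rw [Finset.sum_boole, Finset.filter_mem_eq_inter, Finset.univ_inter]
  have hwP : ∀ x ∈ corPolytope n, w ⬝ᵥ x ≤ S.card := by
    intro x hx
    have := diag_valid n (fun i => if i ∈ S then (1 : ℝ) else if i ∈ S' then -1 else 0) x hx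
    rwa [hσmax] at this
  have hwQ : ∀ y ∈ Q, w ⬝ᵥ y ≤ δQ := fun y hy =>
    dot_le_of_mem_convexHull _ w δQ (by rintro _ ⟨j, rfl⟩; exact hmax j) y (hQ hy)
  have hFG := hasEFOfSize_face_add h w (S.card : ℝ) δQ hwP hwQ
  -- the unique-disjointness data of the face, indexed by subsets of `Fin m`
  let B : Finset (Fin m) → Finset (Fin n) := fun b' => S ∪ b'.map e
  let A : Finset (Fin m) → Finset (Fin n) := fun a' => a'.map e
  have hAB : ∀ a' b', (A a' ∩ B b').card = (a' ∩ b').card := by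
    intro a' b'
    have h1 : A a' ∩ B b' = (a' ∩ b').map e := by
      ext i
      simp only [A, B, Finset.mem_inter, Finset.mem_union, Finset.mem_map]
      constructor
      · rintro ⟨⟨x, hx, rfl⟩, h2 | ⟨y, hy, hxy⟩⟩
        · exact absurd h2 (heS x)
        · have hyx : y = x := e.injective hxy
          subst hyx
          exact ⟨y, ⟨hx, hy⟩, rfl⟩
      · rintro ⟨x, ⟨hxa, hxb⟩, rfl⟩
        exact ⟨⟨x, hxa, rfl⟩, Or.inr ⟨x, hxb, rfl⟩⟩
    rw [h1, Finset.card_map]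
  have hwB : ∀ b', w ⬝ᵥ pt (B b') = S.card := by
    intro b'
    rw [hw, diagDir, diag_pt]
    have hd : Disjoint S (b'.map e) := by
      rw [Finset.disjoint_left]
      rintro i hiS hi
      obtain ⟨x, -, rfl⟩ := Finset.mem_map.1 hi
      exact heS x hiS
    rw [Finset.sum_union hd]
    have h1 : ∑ i ∈ S, (if i ∈ S then (1 : ℝ) else if i ∈ S' then -1 else 0) = S.card := by
      rw [Finset.sum_congr rfl fun i (hi : i ∈ S) => if_pos hi]
      simp
    have h2 : ∑ i ∈ b'.map e, (if i ∈ S then (1 : ℝ) else if i ∈ S' then -1 else 0) = 0 := by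
      refine Finset.sum_eq_zero fun i hi => ?_
      obtain ⟨x, -, rfl⟩ := Finset.mem_map.1 hi
      rw [if_neg (heS x), if_neg (heS' x)]
    rw [h1, h2, add_zero]
  haveI : Nonempty {j : J // w ⬝ᵥ q j = δQ} := ⟨⟨j₀, rfl⟩⟩
  have key := three_pow_le_of_add (α := Fin m) hFG (fun b' => pt (B b'))
    (fun b' => ⟨pt_mem _, hwB b'⟩) (fun a' => cc (A a')) (fun _ => 1)
    (fun a' x hx => cc_valid (A a') x hx.1) ?_ ?_
    (fun j : {j : J // w ⬝ᵥ q j = δQ} => q j.1) (fun j => ⟨hq j.1, j.2⟩)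
    (fun y hy => mem_convexHull_maximisers q w δQ hmax (hQ hy.1) hy.2)
  · simpa [Fintype.card_fin] using key
  · intro a' b' hlt hone
    have := slack (A a') (B b')
    rw [hAB, hone] at this
    norm_num at this
    linarith
  · intro a' b' hab
    have := slack (A a') (B b')
    rw [hAB, Finset.disjoint_iff_inter_eq_empty.1 hab, Finset.card_empty] at this
    norm_num at this
    linarith

/-- **PROP B.**  For disjoint `S, S' ⊆ [n]`: the generators of `Q` maximising `E_S - E_{S'}` number at least
`1.5^{n - |S| - |S'|} / (r + 1)` whenever `xc(COR(n) + Q) ≤ r`.  (`S = S' = ∅` is PROP A.) -/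
theorem corPolytope_add_face_three_pow_le' {n r : ℕ} {Q : Set (Fin (n * n) → ℝ)}
    (h : HasEFOfSize (corPolytope n + Q) r) {J : Type} [Fintype J] [Nonempty J]
    (q : J → (Fin (n * n) → ℝ)) (hq : ∀ j, q j ∈ Q) (hQ : Q ⊆ convexHull ℝ (Set.range q))
    (S S' : Finset (Fin n)) (hSS' : Disjoint S S') :
    ∃ j₀ : J, (∀ j, diagDir S S' ⬝ᵥ q j ≤ diagDir S S' ⬝ᵥ q j₀) ∧
      3 ^ (n - (S.card + S'.card)) ≤
        Fintype.card {j : J // diagDir S S' ⬝ᵥ q j = diagDir S S' ⬝ᵥ q j₀} * (r + 1) *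
          2 ^ (n - (S.card + S'.card)) := by
  classical
  have hR : ((S ∪ S')ᶜ).card = n - (S.card + S'.card) := by
    rw [Finset.card_compl, Fintype.card_fin, Finset.card_union_of_disjoint hSS']
  let e : Fin (n - (S.card + S'.card)) ↪ Fin n := ((S ∪ S')ᶜ.orderEmbOfFin hR).toEmbedding
  have he : ∀ i, e i ∈ (S ∪ S')ᶜ := fun i => Finset.orderEmbOfFin_mem _ hR i
  refine corPolytope_add_face_three_pow_le h q hq hQ S S' e (fun i hi => ?_) (fun i hi => ?_)
  · exact Finset.mem_compl.1 (he i) (Finset.mem_union_left _ hi)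
  · exact Finset.mem_compl.1 (he i) (Finset.mem_union_right _ hi)

/-! ## §5b PROP A♯: a COMMON maximiser of the clique rows already gives `xc ≥ 1.5ⁿ - 1`
(crit-3 g3 / p11 §4's diagonal box `Q□ = -2·[0,1]^h`: the clique certificate does NOT die — pair each row with a
MAXIMISER, not with `-2 diag b`). -/

/-- **PROP A♯ (common maximiser).**  If one point `y₀ ∈ Q` maximises EVERY clique row `udRow a` over `Q`, then
`3ⁿ ≤ (r + 1) · 2ⁿ` for every size-`r` extended formulation of `COR(n) + Q` — the full FMPTW bound, uniformly in
`Q` (boxes `±M·[0,1]^{n×n}`, simplices `M·Δ`, the diagonal boxes `Q□` of the placement note, any `Q` with a vertex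
whose normal cone contains all `2 diag(𝟙_a) - 𝟙_a𝟙_aᵀ`). -/
theorem corPolytope_add_three_pow_le_of_common {n r : ℕ} {Q : Set (Fin (n * n) → ℝ)}
    (h : HasEFOfSize (corPolytope n + Q) r) {y₀ : Fin (n * n) → ℝ} (hy₀ : y₀ ∈ Q)
    (hmax : ∀ a : Finset (Fin n), ∀ y ∈ Q, udRow a ⬝ᵥ y ≤ udRow a ⬝ᵥ y₀) :
    3 ^ n ≤ (r + 1) * 2 ^ n := by
  classical
  obtain ⟨pt_mem, cc_valid, slack, -⟩ := ud_data n
  have key := three_pow_le_of_hits h udPt pt_mem udRow (fun _ => 1) cc_valid ?_ ?_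
    (fun _ : Unit => y₀) (fun _ => hy₀) (fun a => ⟨(), hmax a⟩)
  · simpa [Fintype.card_fin] using key
  · intro a b hlt hone
    have := slack a b
    rw [hone] at this
    norm_num at this
    linarith
  · intro a b hab
    have := slack a b
    rw [Finset.disjoint_iff_inter_eq_empty.1 hab, Finset.card_empty] at this
    norm_num at this
    linarith

/-- **Corollary (down-closed diagonal passengers, e.g. `Q□ = y₀ - M·diag([0,1]ⁿ)`).**  If every point of `Q` is
`y₀ + diag σ` with `σ ≤ 0`, then `y₀` is a common maximiser of the clique rows (`⟨udRow a, diag σ⟩ = Σ_{i∈a} σ_i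
≤ 0`), so `3ⁿ ≤ (r + 1) · 2ⁿ`. -/
theorem corPolytope_add_diagNonpos_three_pow_le {n r : ℕ} {Q : Set (Fin (n * n) → ℝ)}
    (h : HasEFOfSize (corPolytope n + Q) r) {y₀ : Fin (n * n) → ℝ} (hy₀ : y₀ ∈ Q)
    (hQ : ∀ y ∈ Q, ∃ σ : Fin n → ℝ, (∀ i, σ i ≤ 0) ∧ y = y₀ + flat (Matrix.diagonal σ)) :
    3 ^ n ≤ (r + 1) * 2 ^ n := by
  refine corPolytope_add_three_pow_le_of_common h hy₀ fun a y hy => ?_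
  obtain ⟨σ, hσ, rfl⟩ := hQ y hy
  rw [dotProduct_add, udRow_dotProduct_flat_diagonal]
  have : ∑ i ∈ a, σ i ≤ 0 := Finset.sum_nonpos fun i _ => hσ i
  linarith

/-- `⟨flat c, y⟩ = Σ_{ij} c_{ij} · y_{(i,j)}`. [folklore] -/
theorem flat_dotProduct_apply {n : ℕ} (c : Matrix (Fin n) (Fin n) ℝ) (y : Fin (n * n) → ℝ) :
    flat c ⬝ᵥ y = ∑ i, ∑ j, c i j * y (finProdFinEquiv (i, j)) := by
  unfold flat dotProduct
  rw [← finProdFinEquiv.sum_comp]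
  simp only [Equiv.symm_apply_apply]
  rw [Fintype.sum_prod_type]

/-- **PROP A♯ for SIGN-DOMINANT passengers** (answers the re-pointed SUB-QUESTION 2 «off-diagonal boxes»): if `Q`
has a point `y₀` that is coordinatewise MAXIMAL on the diagonal coordinates and MINIMAL off the diagonal (every
axis-parallel box — diagonal, off-diagonal or mixed, any position and size —, every product of intervals, every
order-interval hull in this sign pattern), then `y₀` maximises every clique row (`+` on the diagonal, `-` off it),
so `3ⁿ ≤ (r + 1) · 2ⁿ`. -/
theorem corPolytope_add_three_pow_le_of_dominant {n r : ℕ} {Q : Set (Fin (n * n) → ℝ)}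
    (h : HasEFOfSize (corPolytope n + Q) r) {y₀ : Fin (n * n) → ℝ} (hy₀ : y₀ ∈ Q)
    (hdiag : ∀ y ∈ Q, ∀ i, y (finProdFinEquiv (i, i)) ≤ y₀ (finProdFinEquiv (i, i)))
    (hoff : ∀ y ∈ Q, ∀ i j, i ≠ j → y₀ (finProdFinEquiv (i, j)) ≤ y (finProdFinEquiv (i, j))) :
    3 ^ n ≤ (r + 1) * 2 ^ n := by
  classical
  refine corPolytope_add_three_pow_le_of_common h hy₀ fun a y hy => ?_
  rw [udRow, flat_dotProduct_apply, flat_dotProduct_apply]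
  refine Finset.sum_le_sum fun i _ => Finset.sum_le_sum fun j _ => ?_
  by_cases hij : i = j
  · subst hij
    have hc : 0 ≤ udMat a i i := by
      simp only [udMat, if_true]; rw [udInd_apply]; split_ifs <;> norm_num
    exact mul_le_mul_of_nonneg_left (hdiag y hy i) hc
  · have hc : udMat a i j ≤ 0 := by
      simp only [udMat, if_neg hij]; rw [udInd_apply, udInd_apply]; split_ifs <;> norm_num
    exact mul_le_mul_of_nonpos_left (hoff y hy i j hij) hc

/-! ## §5c PROP D₀: NO diagonal passenger helps — `xc(COR(m+1) + Q) ≥ 1.5^m - 1` for every `Q ⊆ y₀ + diagonals`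
(answers SUB-QUESTION 1 of the price: the diagonal-free projection `conv{(b_i b_j)_{i≠j}}` of `COR(m+1)` has
extension complexity `≥ 1.5^m - 1`).  The certificate is a DIFFERENT row family indexed by COR's combinatorics:
the ANCHORED clique rows `x_z·Σ_{i∈a} x_i - Σ_{i<j∈a} x_i x_j ≤ 1` (anchor `z`, `a ⊆ [m]`), which have no diagonal
entries, are valid on `COR` with slack `(k-1)(k-2)/2`, `k = |a ∩ b|`, on the vertices `b ∋ z` — zero iff
`k ∈ {1, 2}`, one iff `k ∈ {0, 3}`: the unique-disjointness pattern again. -/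

/-- the anchored clique matrix of `a' ⊆ [m]` inside `[m+1]` (anchor `z = last`): quadratic form
`x_z Σ_{i∈A} x_i - ½ (Σ_{i∈A} x_i)² + ½ Σ_{i∈A} x_i²`, `A = castSucc '' a'`; zero diagonal. -/
def anMat {m : ℕ} (a' : Finset (Fin m)) : Matrix (Fin (m + 1)) (Fin (m + 1)) ℝ := fun i j =>
  (if i = Fin.last m then udInd (a'.map Fin.castSuccEmb) j else 0) -
    (1 / 2) * (udInd (a'.map Fin.castSuccEmb) i * udInd (a'.map Fin.castSuccEmb) j -
      (if i = j then udInd (a'.map Fin.castSuccEmb) i else 0))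

theorem last_not_mem_map_castSucc {m : ℕ} (a' : Finset (Fin m)) :
    Fin.last m ∉ a'.map Fin.castSuccEmb := by
  intro h
  obtain ⟨i, -, hi⟩ := Finset.mem_map.1 h
  exact (Fin.castSucc_lt_last i).ne hi

/-- the anchored quadratic form in closed form -/
theorem anMat_quad {m : ℕ} (a' : Finset (Fin m)) (x : Fin (m + 1) → ℝ) :
    ∑ i, ∑ j, anMat a' i j * (x i * x j) =
      x (Fin.last m) * (∑ j, udInd (a'.map Fin.castSuccEmb) j * x j) -
        (1 / 2) * ((∑ j, udInd (a'.map Fin.castSuccEmb) j * x j) *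
            (∑ j, udInd (a'.map Fin.castSuccEmb) j * x j) -
          ∑ j, udInd (a'.map Fin.castSuccEmb) j * (x j * x j)) := by
  set A := a'.map Fin.castSuccEmb
  have h1 : ∀ i, ∑ j, anMat a' i j * (x i * x j) =
      (if i = Fin.last m then x i * ∑ j, udInd A j * x j else 0) -
        (1 / 2) * (udInd A i * x i * ∑ j, udInd A j * x j - udInd A i * (x i * x i)) := by
    intro i
    have : ∀ j, anMat a' i j * (x i * x j) =
        (if i = Fin.last m then x i * (udInd A j * x j) else 0) -
          (1 / 2) * (udInd A i * x i * (udInd A j * x j) -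
            (if i = j then udInd A i * (x i * x j) else 0)) := by
      intro j
      simp only [anMat]
      split_ifs <;> ring
    simp only [this, Finset.sum_sub_distrib, ← Finset.mul_sum, Finset.sum_ite_eq, Finset.mem_univ,
      if_true]
    split_ifs <;> simp [Finset.mul_sum]
  simp only [h1, Finset.sum_sub_distrib, ← Finset.mul_sum, Finset.sum_ite_eq', Finset.mem_univ, if_true,
    ← Finset.sum_mul]

/-- **PROP D₀ (diagonal passengers cannot help).**  For every `Q ⊆ y₀ + {diagonal matrices}` (any size, any
shape — boxes, permutahedra, the whole diagonal subspace): `3^m ≤ (r + 1) · 2^m` whenever `COR(m+1) + Q` has an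
extended formulation of size `r`. -/
theorem corPolytope_succ_add_diag_three_pow_le {m r : ℕ} {Q : Set (Fin ((m + 1) * (m + 1)) → ℝ)}
    (h : HasEFOfSize (corPolytope (m + 1) + Q) r) {y₀ : Fin ((m + 1) * (m + 1)) → ℝ} (hy₀ : y₀ ∈ Q)
    (hQ : ∀ y ∈ Q, ∃ σ : Fin (m + 1) → ℝ, y = y₀ + flat (Matrix.diagonal σ)) :
    3 ^ m ≤ (r + 1) * 2 ^ m := by
  classical
  obtain ⟨pt_mem, -, -, diag_pt⟩ := ud_data (m + 1)
  set z : Fin (m + 1) := Fin.last m with hz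
  let e : Fin m ↪ Fin (m + 1) := Fin.castSuccEmb
  let B : Finset (Fin m) → Finset (Fin (m + 1)) := fun b' => insert z (b'.map e)
  let A : Finset (Fin m) → Finset (Fin (m + 1)) := fun a' => a'.map e
  have hzA : ∀ a', z ∉ A a' := fun a' => last_not_mem_map_castSucc a'
  have hAB : ∀ a' b', (A a' ∩ B b').card = (a' ∩ b').card := by
    intro a' b'
    have : A a' ∩ B b' = (a' ∩ b').map e := by
      show a'.map e ∩ insert z (b'.map e) = _
      rw [Finset.inter_insert_of_notMem (hzA a'), Finset.map_inter]
    rw [this, Finset.card_map]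
  -- the 0/1 sums at the column points
  have hsum : ∀ a' b', ∑ j, udInd (A a') j * udInd (B b') j = ((a' ∩ b').card : ℝ) := by
    intro a' b'; rw [udInd_inter, hAB]
  have hsq : ∀ (a' : Finset (Fin m)) (b : Finset (Fin (m + 1))),
      ∑ j, udInd (A a') j * (udInd b j * udInd b j) = ∑ j, udInd (A a') j * udInd b j := by
    intro a' b; simp only [udInd_sq]
  have hzB : ∀ b', udInd (B b') z = 1 := by
    intro b'; rw [udInd_apply, if_pos (Finset.mem_insert_self _ _)]
  -- slack of the anchored row at the column point: `(k-1)(k-2)/2`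
  have slack : ∀ a' b', 1 - flat (anMat a') ⬝ᵥ udPt (B b') =
      (((a' ∩ b').card : ℝ) - 1) * (((a' ∩ b').card : ℝ) - 2) / 2 := by
    intro a' b'
    show 1 - flat (anMat a') ⬝ᵥ vecOuter (m + 1) (udInd (B b')) = _
    rw [flat_dotProduct_vecOuter, anMat_quad, hsq, hsum, hzB]
    ring
  -- validity on `COR(m+1)`: for 0/1 points the form is `x_z k - (k² - k)/2 ≤ 1`, `k ∈ ℕ`
  have valid01 : ∀ (a' : Finset (Fin m)) (x : Fin (m + 1) → ℝ), (∀ i, x i = 0 ∨ x i = 1) →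
      ∑ i, ∑ j, anMat a' i j * (x i * x j) ≤ 1 := by
    intro a' x hx
    rw [anMat_quad]
    have hxx : ∀ j, x j * x j = x j := fun j => by rcases hx j with h0 | h0 <;> simp [h0]
    simp only [hxx]
    -- `k := Σ_j 𝟙_A j x_j` is a natural number
    obtain ⟨k, hk⟩ : ∃ k : ℕ, ∑ j, udInd (A a') j * x j = k := by
      refine ⟨(Finset.univ.filter fun j => j ∈ A a' ∧ x j = 1).card, ?_⟩
      rw [← Finset.sum_boole]
      refine Finset.sum_congr rfl fun j _ => ?_
      rw [udInd_apply]
      rcases hx j with h0 | h0 <;> by_cases hj : j ∈ A a' <;> simp [h0, hj]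
    rw [hk]
    have hkk : ((k : ℝ) - 1) * ((k : ℝ) - 2) ≥ 0 := by
      rcases Nat.lt_or_ge k 2 with hk2 | hk2
      · interval_cases k <;> norm_num
      · have : (2 : ℝ) ≤ k := by exact_mod_cast hk2
        nlinarith
    have hk0 : (0 : ℝ) ≤ k := Nat.cast_nonneg k
    rcases hx z with h0 | h0 <;> rw [h0] <;> nlinarith
  have valid : ∀ a', ∀ y ∈ corPolytope (m + 1), flat (anMat a') ⬝ᵥ y ≤ 1 := fun a' y hy =>
    flat_dotProduct_le_of_mem_corPolytope hy ⟨(anMat a', 1), fun x hx => valid01 a' x hx⟩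
  -- the anchored rows are blind to diagonal passengers
  have blind : ∀ a' (σ : Fin (m + 1) → ℝ), flat (anMat a') ⬝ᵥ flat (Matrix.diagonal σ) = 0 := by
    intro a' σ
    rw [flat_dotProduct_flat]
    refine Finset.sum_eq_zero fun i _ => ?_
    have hAz : udInd (a'.map Fin.castSuccEmb) (Fin.last m) = 0 := by
      rw [udInd_apply, if_neg (last_not_mem_map_castSucc a')]
    have hdiag0 : anMat a' i i = 0 := by
      simp only [anMat, if_true]
      by_cases hi : i = Fin.last m
      · rw [if_pos hi, hi, hAz]; ring
      · rw [if_neg hi, udInd_sq]; ring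
    rw [Finset.sum_eq_single i]
    · rw [hdiag0, zero_mul]
    · intro j _ hji; rw [Matrix.diagonal_apply_ne _ (Ne.symm hji), mul_zero]
    · intro hi; exact absurd (Finset.mem_univ i) hi
  have key := three_pow_le_of_hits h (fun b' => udPt (B b')) (fun b' => pt_mem _)
    (fun a' => flat (anMat a')) (fun _ => 1) valid ?_ ?_
    (fun _ : Unit => y₀) (fun _ => hy₀) (fun a' => ⟨(), fun y hy => ?_⟩)
  · simpa [Fintype.card_fin] using key
  · intro a' b' hlt hone
    have := slack a' b'
    rw [hone] at this
    norm_num at this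
    linarith
  · intro a' b' hab
    have := slack a' b'
    rw [Finset.disjoint_iff_inter_eq_empty.1 hab, Finset.card_empty] at this
    norm_num at this
    linarith
  · obtain ⟨σ, rfl⟩ := hQ y hy
    rw [dotProduct_add, blind, add_zero]

/-! ## §6 The crux chain in Newton-polytope / extension-complexity currency -/

open Literature.Computability.AlgebraicComplexity (complexity nestFreeMatchingPoly)
open Literature.Computability.AlgebraicComplexity.MonotoneCircuitEF (hasEFOfSize_newtonPolytope_complexity)
open Literature.Algebra.Polynomial.NewtonPolytope (newtonPolytope newtonPolytope_mul)

/-- threshold currency of the route: `T c n = 2^((log₂ n + c)^c)` -/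
abbrev T (c n : ℕ) : ℕ := 2 ^ ((Nat.log 2 n + c) ^ c)

/-- real Newton polytope of a polynomial over `ℝ≥0` -/
abbrev newtR {σ : Type} (f : MvPolynomial σ ℝ≥0) : Set (σ → ℝ) :=
  newtonPolytope (MvPolynomial.map NNReal.toRealHom f)

/-- **XC-MINKOWSKI (polyhedral form of the division crux)**: for every `c`, eventually in `n`, no Minkowski sum
`NFP_n + Newt(h)` (`h ≠ 0` over `ℝ≥0`) has an extended formulation of size `3·2^((log₂ n + c)^c)`. -/
def XcMinkowskiHard : Prop :=
  ∀ c : ℕ, ∃ n₀ : ℕ, ∀ n ≥ n₀, ∀ h : MvPolynomial (Fin (2 * n) × Fin (2 * n)) ℝ≥0, h ≠ 0 →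
    ¬ HasEFOfSize (newtR (nestFreeMatchingPoly n ℝ≥0) + newtR h) (3 * T c n)

/-- **N3 — all multiples of `NN_n` are hard** (the shadow line's `NNMultiplesHard`). -/
def NNMultiplesHard : Prop :=
  ∀ c : ℕ, ∃ n₀ : ℕ, ∀ n ≥ n₀, ∀ h : MvPolynomial (Fin (2 * n) × Fin (2 * n)) ℝ≥0, h ≠ 0 →
    T c n < complexity (nestFreeMatchingPoly n ℝ≥0 * h)

/-- the route crux stmt-21181 over the library polynomial (definitionally the route's inlined `NN_n`). -/
def NNDivisionHardLit : Prop :=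
  ∀ c : ℕ, ∃ n₀ : ℕ, ∀ n ≥ n₀, ∀ h : MvPolynomial (Fin (2 * n) × Fin (2 * n)) ℝ≥0, h ≠ 0 →
    T c n < complexity (nestFreeMatchingPoly n ℝ≥0 * h) + complexity h

example : NNDivisionHardLit ↔ Summit.ValiantsHypothesis.ValiantsHypothesis.Theses.FifoMatching.NNDivisionHard :=
  Iff.rfl

/-- **COR-MINKOWSKI — crux K (the n-free crux, graph currency, in the route's quasi-polynomial rate)**: for every
`c`, eventually in `h`, every Minkowski sum of `COR(K_h)` with a polytope `conv{q_0, …, q_K}` has extension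
complexity `> T c h = 2^((log₂ h + c)^c)`.  Q-free form (Shephard): every polytope whose normal fan refines the
normal fan of `COR(K_h) ≅ CUT_{h+1}` has super-quasi-polynomial extension complexity.  OPEN (not in print to the
searches on the card; implies HY21 Problem 2 = Jukna 2023 Problem 4 for `NN_n` via this file).  What is PROVED here:
PROP A (`K + 1 ≥ 1.5^h/(r+1)`), PROP A♯ (a common maximiser of the clique rows ⇒ `r + 1 ≥ 1.5^h`), PROP B (every
`E_S - E_{S'}` face of `Q` needs `1.5^{h-|S|-|S'|}/(r+1)` vertices), PROP D₀ (diagonal passengers: `r + 1 ≥ 1.5^{h-1}`). -/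
def CorMinkowskiHard : Prop :=
  ∀ c : ℕ, ∃ h₀ : ℕ, ∀ h ≥ h₀, ∀ (K : ℕ) (q : Fin (K + 1) → (Fin h × Fin h → ℝ)) (r : ℕ),
    HasEFOfSize (corPolytopeGraph (⊤ : SimpleGraph (Fin h)) + convexHull ℝ (Set.range q)) r → T c h < r

/-- **COR-MINKOWSKI, exponential form K⁺** (the natural conjecture; sanity cap `c ≤ 2` from the zonotope on COR's
edge directions, see the card): some `c > 0` with `xc(COR(K_h) + Q) ≥ 2^{c h} - 1` for all large `h` and all
polytopes `Q`.  `K⁺ ⇒ K` (`corMinkowskiHard_of_exp`). -/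
def CorMinkowskiExpHard : Prop :=
  ∃ c : ℝ, 0 < c ∧ ∃ h₀ : ℕ, ∀ h ≥ h₀, ∀ (K : ℕ) (q : Fin (K + 1) → (Fin h × Fin h → ℝ)) (r : ℕ),
    HasEFOfSize (corPolytopeGraph (⊤ : SimpleGraph (Fin h)) + convexHull ℝ (Set.range q)) r →
      (2 : ℝ) ^ (c * h) ≤ r + 1

open Summit.ValiantsHypothesis.ValiantsHypothesis.Theorems.FifoMatching.QueueGridFace (growth_eventually) in
/-- `K⁺ ⇒ K`: an exponential bound beats every threshold `T c h` eventually (c1's `growth_eventually`). -/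
theorem corMinkowskiHard_of_exp (hK : CorMinkowskiExpHard) : CorMinkowskiHard := by
  obtain ⟨c, hc, h₀, hh₀⟩ := hK
  intro c₀
  obtain ⟨r₀, hr₀2, hgrowth⟩ := growth_eventually c₀ hc
  refine ⟨max h₀ r₀, fun h hh K q r hEF => ?_⟩
  have hh₀' : h₀ ≤ h := le_trans (le_max_left _ _) hh
  have hr₀' : r₀ ≤ h := le_trans (le_max_right _ _) hh
  have h1 : (1 : ℝ) ≤ h := by exact_mod_cast (show 1 ≤ h by omega)
  have hexp := hh₀ h hh₀' K q r hEF
  have hg := hgrowth h hr₀'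
  have hmono : (2 : ℝ) ^ (c * ((h / 2 : ℕ) : ℝ)) ≤ (2 : ℝ) ^ (c * h) := by
    apply Real.rpow_le_rpow_of_exponent_le (by norm_num)
    have : ((h / 2 : ℕ) : ℝ) ≤ (h : ℝ) := by exact_mod_cast Nat.div_le_self h 2
    nlinarith
  have hT : ((T c₀ h : ℕ) : ℝ) = (2 : ℝ) ^ ((Nat.log 2 h + c₀) ^ c₀) := by
    simp [T]
  have h4 : (4 : ℝ) ≤ 4 * (h : ℝ) ^ 4 := by
    have := one_le_pow₀ (M₀ := ℝ) (n := 4) h1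
    linarith
  have : ((T c₀ h : ℕ) : ℝ) < r := by rw [hT]; linarith
  exact_mod_cast this

/-- **THE TRANSPORT — seam T (typed, to be proved from the K1 chain)**: the located face of `NFP_n` onto
`COR(K_h)`, `h = Ω(√n)` (A1 `queueGridZeroOnePoints_holds` + `corMap_image_queueGridPP` + item 27045
`AboulkerEtAl2019_gridCorCliqueFace`, all theorems), carried WITH a passenger by `hasEFOfSize_face_add`,
`hasEFOfSize_image_add` and `mem_convexHull_maximisers` (§2, §5, proved), turns COR-MINKOWSKI into XC-MINKOWSKI. -/
def XcTransport : Prop := CorMinkowskiHard → XcMinkowskiHard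

/-- **FIRST LEMMA (PROVED)**: XC-Minkowski hardness ⇒ all multiples of `NN_n` are hard for monotone CIRCUITS —
degree-free, by the hypergraph-flow EF of a monotone circuit's Newton polytope (`xc(Newt f) ≤ 3·L₊(f)`) and
`Newt(g·h) = Newt g + Newt h` over `ℝ≥0`. -/
theorem multiplesHard_of_xcMinkowski (hX : XcMinkowskiHard) : NNMultiplesHard := by
  intro c
  obtain ⟨n₀, hn₀⟩ := hX c
  refine ⟨n₀, fun n hn h hh => ?_⟩
  by_contra hle
  push Not at hle
  have hEF := hasEFOfSize_newtonPolytope_complexity (nestFreeMatchingPoly n ℝ≥0 * h)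
  rw [map_mul, newtonPolytope_mul] at hEF
  exact hn₀ n hn h hh (hEF.of_le (by omega))

/-- N3 ⇒ 21181 (drop the uncharged `L₊(h)`). -/
theorem nnDivisionHard_of_multiples (hM : NNMultiplesHard) : NNDivisionHardLit := by
  intro c
  obtain ⟨n₀, hn₀⟩ := hM c
  exact ⟨n₀, fun n hn h hh => lt_of_lt_of_le (hn₀ n hn h hh) (Nat.le_add_right _ _)⟩

/-- ★ XC-MINKOWSKI ⇒ the route crux stmt-ValiantsHypothesis-21181 BY NAME. -/
theorem route_21181_of_xcMinkowski (hX : XcMinkowskiHard) :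
    Summit.ValiantsHypothesis.ValiantsHypothesis.Theses.FifoMatching.NNDivisionHard :=
  nnDivisionHard_of_multiples (multiplesHard_of_xcMinkowski hX)

/-- ★ COR-MINKOWSKI + the transport ⇒ 21181 BY NAME (the line's composition; the two open inputs explicit). -/
theorem route_21181_of_corMinkowski (hT : XcTransport) (hC : CorMinkowskiHard) :
    Summit.ValiantsHypothesis.ValiantsHypothesis.Theses.FifoMatching.NNDivisionHard :=
  route_21181_of_xcMinkowski (hT hC)

/-- ★ the exponential conjecture K⁺ + the transport ⇒ 21181 BY NAME. -/
theorem route_21181_of_corMinkowskiExp (hT : XcTransport) (hC : CorMinkowskiExpHard) :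
    Summit.ValiantsHypothesis.ValiantsHypothesis.Theses.FifoMatching.NNDivisionHard :=
  route_21181_of_corMinkowski hT (corMinkowskiHard_of_exp hC)

/-! ## §7 THE GEOMETRIC TRANSPORT (PROVED): an EF of `NFP_n + Newt(h)` is an EF of `COR(K_{h'}) + Q'`,
`h' ≥ c·g`, for every cofactor `h ≠ 0` — K1's located face (A1 `queueGridZeroOnePoints_holds`, c1's `corMap`,
AFHMS's clique face 27045) carried WITH the passenger by §2 and `mem_convexHull_maximisers`. -/

open Summit.ValiantsHypothesis.ValiantsHypothesis.Theorems.FifoMatching.QueueGridFace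
  (realOf suppPts newt QGV patternVec queueGridPP corMap corMap_image_queueGridPP newt_nonneg)
open Summit.ValiantsHypothesis.ValiantsHypothesis.Theorems.FifoMatching.GridCorShadow (queueGridZeroOnePoints_holds)
open Summit.ValiantsHypothesis.ValiantsHypothesis.Theorems.FifoMatching.MonomialCofactor (newt_eq_newtonPolytope)
open Literature.Combinatorics.Optimization (AboulkerEtAl2019_gridCorCliqueFace)
open Literature.Computability.MetaComplexity (gridGraph)

/-- the face of `conv{q j}` in direction `w` (cut at its maximum `δ`) is the hull of the maximising generators. -/
theorem convexHull_range_inter_eq {ι J : Type} [Fintype ι] (q : J → ι → ℝ) (w : ι → ℝ) (δ : ℝ)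
    (hle : ∀ j, w ⬝ᵥ q j ≤ δ) :
    convexHull ℝ (Set.range q) ∩ {y | w ⬝ᵥ y = δ} =
      convexHull ℝ (Set.range fun j : {j : J // w ⬝ᵥ q j = δ} => q j.1) := by
  ext y
  constructor
  · rintro ⟨hy, hyw⟩; exact mem_convexHull_maximisers q w δ hle hy hyw
  · intro hy
    refine ⟨convexHull_mono (by rintro _ ⟨j, rfl⟩; exact ⟨j.1, rfl⟩) hy, ?_⟩
    have h1 := dot_le_of_mem_convexHull _ w δ (by rintro _ ⟨j, rfl⟩; exact le_of_eq j.2) y hy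
    have h2 := dot_le_of_mem_convexHull _ (-w) (-δ)
      (by rintro _ ⟨j, rfl⟩; rw [neg_dotProduct]; exact neg_le_neg (le_of_eq j.2.symm)) y hy
    rw [neg_dotProduct] at h2
    show w ⬝ᵥ y = δ
    linarith

/-- reindex a nonempty finite family by `Fin (K + 1)`. -/
theorem exists_fin_range_eq {α J : Type} [Fintype J] [Nonempty J] (q : J → α) :
    ∃ (K : ℕ) (q' : Fin (K + 1) → α), Set.range q' = Set.range q := by
  obtain ⟨K, hK⟩ := Nat.exists_eq_succ_of_ne_zero (Fintype.card_ne_zero (α := J))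
  let e : J ≃ Fin (K + 1) := (Fintype.equivFin J).trans (finCongr hK)
  exact ⟨K, q ∘ e.symm, e.symm.surjective.range_comp q⟩

/-- **ONE TRANSPORT STEP.**  A valid inequality `w · x ≤ δ` of `P` and a linear map `L` carry an extended
formulation of `P + conv{q j}` to one, of the same size, of `L(F_w(P)) + conv{q' j'}`, where the `q'` are the
`L`-images of the `w`-maximising generators `q j` (faces and images distribute over Minkowski sums). -/
theorem transport_step {ι κ J : Type} [Fintype ι] [Fintype κ] [Fintype J] [Nonempty J]
    {P : Set (ι → ℝ)} (q : J → ι → ℝ) {r : ℕ} (h : HasEFOfSize (P + convexHull ℝ (Set.range q)) r)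
    (w : ι → ℝ) (δ : ℝ) (hP : ∀ x ∈ P, w ⬝ᵥ x ≤ δ) (L : (ι → ℝ) →ₗ[ℝ] (κ → ℝ)) :
    ∃ (K : ℕ) (q' : Fin (K + 1) → κ → ℝ),
      HasEFOfSize (L '' (P ∩ {x | w ⬝ᵥ x = δ}) + convexHull ℝ (Set.range q')) r := by
  classical
  obtain ⟨j₀, -, hj₀⟩ :=
    Finset.exists_max_image Finset.univ (fun j => w ⬝ᵥ q j) Finset.univ_nonempty
  have hle : ∀ j, w ⬝ᵥ q j ≤ w ⬝ᵥ q j₀ := fun j => hj₀ j (Finset.mem_univ _)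
  have hQ : ∀ y ∈ convexHull ℝ (Set.range q), w ⬝ᵥ y ≤ w ⬝ᵥ q j₀ :=
    dot_le_of_mem_convexHull _ w _ (by rintro _ ⟨j, rfl⟩; exact hle j)
  have h2 := hasEFOfSize_image_add (hasEFOfSize_face_add h w δ _ hP hQ) L
  rw [convexHull_range_inter_eq q w _ hle, LinearMap.image_convexHull, ← Set.range_comp] at h2
  haveI : Nonempty {j : J // w ⬝ᵥ q j = w ⬝ᵥ q j₀} := ⟨⟨j₀, rfl⟩⟩
  obtain ⟨K, q', hq'⟩ := exists_fin_range_eq (L ∘ fun j : {j : J // w ⬝ᵥ q j = w ⬝ᵥ q j₀} => q j.1)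
  exact ⟨K, q', by rw [hq']; exact h2⟩

/-- a face cut by finitely many valid inequalities is the face cut by their sum. -/
theorem inter_forall_eq_inter_sum {ι : Type} [Fintype ι] {k : ℕ} (P : Set (ι → ℝ))
    (cv : Fin k → ι → ℝ) (δ : Fin k → ℝ) (hvalid : ∀ i, ∀ x ∈ P, cv i ⬝ᵥ x ≤ δ i) :
    P ∩ {x | ∀ i, cv i ⬝ᵥ x = δ i} = P ∩ {x | (fun e => ∑ i, cv i e) ⬝ᵥ x = ∑ i, δ i} := by
  have hsum : ∀ x : ι → ℝ, (fun e => ∑ i, cv i e) ⬝ᵥ x = ∑ i, cv i ⬝ᵥ x := by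
    intro x
    simp only [dotProduct, Finset.sum_mul]
    rw [Finset.sum_comm]
  ext x
  simp only [Set.mem_inter_iff, Set.mem_setOf_eq, hsum]
  constructor
  · rintro ⟨hx, h⟩; exact ⟨hx, Finset.sum_congr rfl fun i _ => h i⟩
  · rintro ⟨hx, h⟩
    exact ⟨hx, fun i => (Finset.sum_eq_sum_iff_of_le fun i _ => hvalid i x hx).1 h i (Finset.mem_univ _)⟩

theorem sum_dotProduct_le {ι : Type} [Fintype ι] {k : ℕ} (P : Set (ι → ℝ))
    (cv : Fin k → ι → ℝ) (δ : Fin k → ℝ) (hvalid : ∀ i, ∀ x ∈ P, cv i ⬝ᵥ x ≤ δ i) :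
    ∀ x ∈ P, (fun e => ∑ i, cv i e) ⬝ᵥ x ≤ ∑ i, δ i := by
  intro x hx
  have : (fun e => ∑ i, cv i e) ⬝ᵥ x = ∑ i, cv i ⬝ᵥ x := by
    simp only [dotProduct, Finset.sum_mul]
    rw [Finset.sum_comm]
  rw [this]
  exact Finset.sum_le_sum fun i _ => hvalid i x hx

/-- the A1 coordinate face of `Newt(NN_n)` written with ONE valid functional `w_Z = -Σ_{e∈Z} x_e ≤ 0`. -/
theorem newt_inter_zeroSet_eq {σ : Type} [Fintype σ] [DecidableEq σ] (f : MvPolynomial σ ℝ≥0) (Z : Finset σ) :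
    newt f ∩ {x | (fun e => if e ∈ Z then (-1 : ℝ) else 0) ⬝ᵥ x = 0} =
      convexHull ℝ (suppPts f ∩ {x | ∀ e ∈ Z, x e = 0}) := by
  classical
  set w : σ → ℝ := fun e => if e ∈ Z then (-1 : ℝ) else 0 with hwdef
  have hw : ∀ x : σ → ℝ, w ⬝ᵥ x = -∑ e ∈ Z, x e := by
    intro x
    simp only [dotProduct, hwdef, ite_mul, neg_one_mul, zero_mul]
    rw [Finset.sum_ite_mem, Finset.univ_inter, Finset.sum_neg_distrib]
  -- support points as a range
  let q : f.support → σ → ℝ := fun d => realOf d.1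
  have hS : suppPts f = Set.range q := by
    unfold suppPts; rw [Set.image_eq_range]; rfl
  have hq0 : ∀ j, ∀ e, 0 ≤ q j e := fun j e => Nat.cast_nonneg _
  have hle : ∀ j, w ⬝ᵥ q j ≤ 0 := fun j => by
    rw [hw]; exact neg_nonpos.2 (Finset.sum_nonneg fun e _ => hq0 j e)
  have hzero : ∀ j, w ⬝ᵥ q j = 0 ↔ ∀ e ∈ Z, q j e = 0 := fun j => by
    rw [hw, neg_eq_zero, Finset.sum_eq_zero_iff_of_nonneg fun e _ => hq0 j e]
  unfold newt
  rw [hS, convexHull_range_inter_eq q w 0 hle]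
  congr 1
  ext x
  constructor
  · rintro ⟨j, rfl⟩; exact ⟨⟨j.1, rfl⟩, (hzero j.1).1 j.2⟩
  · rintro ⟨⟨j, rfl⟩, hx⟩; exact ⟨⟨j, (hzero j).2 hx⟩, rfl⟩

/-- **THE GEOMETRIC TRANSPORT (PROVED).**  With the constants `c, t₀` of AFHMS's clique face (item 27045): for all
`r ≥ 1`, `n ≥ (r+1)(2r+1)`, `2g ≤ r`, `g ≥ t₀`, every cofactor `h ≠ 0` and every size `s`, an extended formulation
of `Newt(NN_n) + Newt(h)` of size `s` yields `h' ≥ c·g` and finitely many points `q` with an extended formulation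
of `COR(K_{h'}) + conv{q}` of size `s`. -/
theorem transport_geometric :
    ∃ c : ℝ, 0 < c ∧ ∃ t₀ : ℕ, ∀ (n r g : ℕ), 1 ≤ r → (r + 1) * (2 * r + 1) ≤ n → ∀ (hg : 2 * g ≤ r), t₀ ≤ g →
      ∀ (hh : MvPolynomial (Fin (2 * n) × Fin (2 * n)) ℝ≥0), hh ≠ 0 → ∀ s : ℕ,
        HasEFOfSize (newtR (nestFreeMatchingPoly n ℝ≥0) + newtR hh) s →
          ∃ h : ℕ, c * g ≤ h ∧ ∃ (K : ℕ) (q : Fin (K + 1) → (Fin h × Fin h → ℝ)),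
            HasEFOfSize (corPolytopeGraph (⊤ : SimpleGraph (Fin h)) + convexHull ℝ (Set.range q)) s := by
  classical
  obtain ⟨c, hc, t₀, hface⟩ := AboulkerEtAl2019_gridCorCliqueFace
  refine ⟨c, hc, t₀, fun n r g hr hn hg ht hh hh0 s hEF => ?_⟩
  -- Step 0: Newton polytopes as hulls of their support points
  have hEF' : HasEFOfSize (newt (nestFreeMatchingPoly n ℝ≥0) + newt hh) s := by
    rw [newt_eq_newtonPolytope, newt_eq_newtonPolytope]; exact hEF
  haveI : Nonempty hh.support := (MvPolynomial.support_nonempty.2 hh0).coe_sort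
  let q₀ : hh.support → (Fin (2 * n) × Fin (2 * n)) → ℝ := fun d => realOf d.1
  have hQ : newt hh = convexHull ℝ (Set.range q₀) := by
    unfold newt suppPts; rw [Set.image_eq_range]; rfl
  rw [hQ] at hEF'
  -- Step 1: the A1 coordinate face, read out onto `PP_r`
  obtain ⟨Z, f, hA1⟩ := queueGridZeroOnePoints_holds r n hr hn
  let w : (Fin (2 * n) × Fin (2 * n)) → ℝ := fun e => if e ∈ Z then (-1 : ℝ) else 0
  have hw : ∀ x : (Fin (2 * n) × Fin (2 * n)) → ℝ, w ⬝ᵥ x = -∑ e ∈ Z, x e := by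
    intro x
    simp only [dotProduct, w, ite_mul, neg_one_mul, zero_mul]
    rw [Finset.sum_ite_mem, Finset.univ_inter, Finset.sum_neg_distrib]
  have hP : ∀ x ∈ newt (nestFreeMatchingPoly n ℝ≥0), w ⬝ᵥ x ≤ 0 := fun x hx => by
    rw [hw]; exact neg_nonpos.2 (Finset.sum_nonneg fun e _ => newt_nonneg _ x hx e)
  let Lf : ((Fin (2 * n) × Fin (2 * n)) → ℝ) →ₗ[ℝ] ((QGV r × QGV r) × Bool × Bool → ℝ) :=
    LinearMap.funLeft ℝ ℝ f
  obtain ⟨K₁, q₁, h₁⟩ := transport_step q₀ hEF' w 0 hP Lf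
  have hF : Lf '' (newt (nestFreeMatchingPoly n ℝ≥0) ∩ {x | w ⬝ᵥ x = 0}) = queueGridPP r := by
    rw [newt_inter_zeroSet_eq, LinearMap.image_convexHull]
    unfold queueGridPP
    congr 1
  rw [hF] at h₁
  -- Step 2: c1's coordinate-linear map onto `COR(G_g)`
  have h₂ := hasEFOfSize_image_add h₁ (corMap r g hg)
  rw [corMap_image_queueGridPP, LinearMap.image_convexHull, ← Set.range_comp,
    ← Summit.ValiantsHypothesis.ValiantsHypothesis.Theorems.FifoMatching.QueueGridFace.corPolytopeGraph_eq] at h₂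
  -- Step 3: AFHMS's face of `COR(G_g)` onto `COR(K_h)`, as ONE valid functional
  obtain ⟨h, hch, k, cv, δ, π, hvalid, hπ⟩ := hface g ht
  obtain ⟨K₃, q₃, h₃⟩ := transport_step (⇑(corMap r g hg) ∘ q₁) h₂ (fun e => ∑ i, cv i e) (∑ i, δ i)
    (sum_dotProduct_le _ cv δ hvalid) π
  rw [← inter_forall_eq_inter_sum _ cv δ hvalid, hπ] at h₃
  exact ⟨h, hch, K₃, q₃, h₃⟩

/-! ## §8 THE TRANSPORT `XcTransport` (PROVED): COR-MINKOWSKI ⇒ XC-MINKOWSKI, hence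
`CorMinkowskiHard → Theses.FifoMatching.NNDivisionHard` with NO other open input. -/

/-- threshold arithmetic: if `n < h⁴` then `(T c n)⁴ ≤ T (4^(c+1) + c + 1) h`. -/
theorem T_pow_four_le {c n h : ℕ} (hn : n ≠ 0) (hh : n < h ^ 4) :
    (T c n) ^ 4 ≤ T (4 ^ (c + 1) + c + 1) h := by
  have h2 : 1 < 2 := by norm_num
  have hlog : Nat.log 2 n < 4 * (Nat.log 2 h + 1) := by
    rw [Nat.log_lt_iff_lt_pow h2 hn]
    calc n < h ^ 4 := hh
      _ ≤ (2 ^ (Nat.log 2 h + 1)) ^ 4 := Nat.pow_le_pow_left (Nat.lt_pow_succ_log_self h2 h).le 4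
      _ = 2 ^ (4 * (Nat.log 2 h + 1)) := by rw [← pow_mul, mul_comm]
  obtain ⟨p, hp⟩ : ∃ p, p = 4 ^ (c + 1) := ⟨_, rfl⟩
  obtain ⟨L, hL⟩ : ∃ L, L = Nat.log 2 h := ⟨_, rfl⟩
  rw [← hL] at hlog
  have hp4 : p = 4 * 4 ^ c := by rw [hp, pow_succ, mul_comm]
  have hbase : Nat.log 2 n + c ≤ 4 * (L + c + 1) := by omega
  have h1 : (Nat.log 2 n + c) ^ c ≤ 4 ^ c * (L + c + 1) ^ c := by
    calc (Nat.log 2 n + c) ^ c ≤ (4 * (L + c + 1)) ^ c := Nat.pow_le_pow_left hbase c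
      _ = 4 ^ c * (L + c + 1) ^ c := mul_pow 4 _ c
  have h3 : 4 * (Nat.log 2 n + c) ^ c ≤ (L + (p + c + 1)) ^ (p + c + 1) := by
    calc 4 * (Nat.log 2 n + c) ^ c ≤ 4 * (4 ^ c * (L + c + 1) ^ c) := Nat.mul_le_mul_left 4 h1
      _ = p * (L + c + 1) ^ c := by rw [hp4]; ring
      _ ≤ (L + (p + c + 1)) * (L + (p + c + 1)) ^ c :=
          Nat.mul_le_mul (by omega) (Nat.pow_le_pow_left (by omega) c)
      _ = (L + (p + c + 1)) ^ (c + 1) := by rw [pow_succ]; ring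
      _ ≤ (L + (p + c + 1)) ^ (p + c + 1) := Nat.pow_le_pow_right (by omega) (by omega)
  rw [hL] at h3
  rw [← hp]
  calc (T c n) ^ 4 = 2 ^ (4 * (Nat.log 2 n + c) ^ c) := by rw [T, ← pow_mul, mul_comm]
    _ ≤ 2 ^ ((Nat.log 2 h + (p + c + 1)) ^ (p + c + 1)) := Nat.pow_le_pow_right (by norm_num) h3

/-- ★ **THE TRANSPORT IS A THEOREM**: `XcTransport` holds — COR-MINKOWSKI (crux K) implies XC-MINKOWSKI. -/
theorem xcTransport_holds : XcTransport := by
  intro hK c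
  obtain ⟨cA, hcA, t₀, htrans⟩ := transport_geometric
  obtain ⟨h₀, hh₀⟩ := hK (4 ^ (c + 1) + c + 1)
  -- constants
  set cm : ℝ := min cA 1 with hcm
  have hcm0 : 0 < cm := lt_min hcA one_pos
  have hcmA : cm ≤ cA := min_le_left _ _
  have hcm1 : cm ≤ 1 := min_le_right _ _
  obtain ⟨S₁, hS₁⟩ := exists_nat_ge ((20 / cm) ^ 2)
  obtain ⟨S₀, hS₀a, hS₀b, hS₀c, hS₀d⟩ :
      ∃ S₀ : ℕ, 4 * t₀ + 4 ≤ S₀ ∧ h₀ ^ 2 ≤ S₀ ∧ S₁ ≤ S₀ ∧ 16 ≤ S₀ :=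
    ⟨4 * t₀ + 4 + h₀ ^ 2 + S₁ + 16, by omega, by omega, by omega, by omega⟩
  refine ⟨S₀ ^ 2, fun n hn hh hh0 hEF => ?_⟩
  obtain ⟨s, hs⟩ : ∃ s, s = Nat.sqrt n := ⟨_, rfl⟩
  have hsS : S₀ ≤ s := by rw [hs]; exact Nat.le_sqrt'.2 hn
  have hss : s ^ 2 ≤ n := by rw [hs]; exact Nat.sqrt_le' n
  have hns : n < (s + 1) ^ 2 := by rw [hs]; exact Nat.lt_succ_sqrt' n
  obtain ⟨g, hg⟩ : ∃ g, g = s / 4 := ⟨_, rfl⟩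
  have h4g : 4 * g ≤ s := by rw [hg]; exact Nat.mul_div_le s 4
  have hg4 : s < 4 * (g + 1) := by rw [hg]; omega
  have hg1 : 1 ≤ g := by omega
  have hgt : t₀ ≤ g := by omega
  have hn' : (2 * g + 1) * (2 * (2 * g) + 1) ≤ n := by nlinarith [Nat.mul_le_mul h4g h4g]
  obtain ⟨h, hch, K, q, hEF'⟩ :=
    htrans n (2 * g) g (by omega) hn' (le_refl _) hgt hh hh0 (3 * T c n) hEF
  -- `h` is large: `h ≥ √s + 1`
  have hsqrt_s : Real.sqrt s * Real.sqrt s = s := Real.mul_self_sqrt (Nat.cast_nonneg s)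
  have hreal : Real.sqrt s + 1 ≤ (h : ℝ) := by
    have hS₁s : ((20 / cm) ^ 2 : ℝ) ≤ s := le_trans hS₁ (by exact_mod_cast (show S₁ ≤ s by omega))
    have hsq : 20 / cm ≤ Real.sqrt s := by
      rw [show (20 / cm : ℝ) = Real.sqrt ((20 / cm) ^ 2) by rw [Real.sqrt_sq (by positivity)]]
      exact Real.sqrt_le_sqrt hS₁s
    have h20 : 20 ≤ cm * Real.sqrt s := by
      have := mul_le_mul_of_nonneg_left hsq hcm0.le
      rwa [show cm * (20 / cm) = 20 by field_simp] at this
    have hg_real : (s : ℝ) / 4 - 1 ≤ g := by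
      have : (s : ℝ) < 4 * ((g : ℝ) + 1) := by exact_mod_cast hg4
      linarith
    have h1 : cm * ((s : ℝ) / 4 - 1) ≤ h :=
      calc cm * ((s : ℝ) / 4 - 1) ≤ cm * g := mul_le_mul_of_nonneg_left hg_real hcm0.le
        _ ≤ cA * g := mul_le_mul_of_nonneg_right hcmA (Nat.cast_nonneg g)
        _ ≤ h := hch
    have h2 : 20 * Real.sqrt s ≤ cm * s := by
      have := mul_le_mul_of_nonneg_right h20 (Real.sqrt_nonneg s)
      rw [mul_assoc, hsqrt_s] at this
      exact this
    have hs1 : 1 ≤ Real.sqrt s := by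
      rw [show (1 : ℝ) = Real.sqrt 1 by simp]
      exact Real.sqrt_le_sqrt (by exact_mod_cast (show 1 ≤ s by omega))
    nlinarith
  -- consequences in ℕ: `h ≥ h₀` and `n < h⁴`
  have hh₀' : h₀ ≤ h := by
    have : (h₀ : ℝ) ≤ Real.sqrt s := by
      rw [show (h₀ : ℝ) = Real.sqrt ((h₀ : ℝ) ^ 2) by rw [Real.sqrt_sq (Nat.cast_nonneg _)]]
      exact Real.sqrt_le_sqrt (by exact_mod_cast (show h₀ ^ 2 ≤ s by omega))
    exact_mod_cast (by linarith : (h₀ : ℝ) ≤ h)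
  have hn4 : n < h ^ 4 := by
    have hs1 : s + 1 ≤ h ^ 2 := by
      have : (s : ℝ) + 1 ≤ (h : ℝ) ^ 2 := by nlinarith [Real.sqrt_nonneg s]
      exact_mod_cast this
    calc n < (s + 1) ^ 2 := hns
      _ ≤ (h ^ 2) ^ 2 := Nat.pow_le_pow_left hs1 2
      _ = h ^ 4 := by rw [← pow_mul]
  have hn0 : n ≠ 0 := by
    have : 16 ^ 2 ≤ s ^ 2 := Nat.pow_le_pow_left (by omega) 2
    omega
  have hT := T_pow_four_le (c := c) hn0 hn4
  have hlt := hh₀ h hh₀' K q (3 * T c n) hEF'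
  have hT2 : 2 ≤ T c n := by
    show 2 ^ 1 ≤ 2 ^ _
    exact Nat.pow_le_pow_right (by norm_num)
      (Nat.one_le_pow _ _ (by
        have h256 : 16 ^ 2 ≤ S₀ ^ 2 := Nat.pow_le_pow_left hS₀d 2
        have := Nat.log_pos one_lt_two (show 2 ≤ n by omega)
        omega))
  have h8 : 8 * T c n ≤ (T c n) ^ 4 := by
    have : 2 ^ 3 ≤ (T c n) ^ 3 := Nat.pow_le_pow_left hT2 3
    calc 8 * T c n = 2 ^ 3 * T c n := by norm_num
      _ ≤ (T c n) ^ 3 * T c n := Nat.mul_le_mul_right _ this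
      _ = (T c n) ^ 4 := by ring
  omega

/-- ★★ **COR-MINKOWSKI ⇒ stmt-ValiantsHypothesis-21181 BY NAME, unconditionally in everything else**
(the line's single remaining open input is the crux K). -/
theorem route_21181_of_corMinkowski' (hC : CorMinkowskiHard) :
    Summit.ValiantsHypothesis.ValiantsHypothesis.Theses.FifoMatching.NNDivisionHard :=
  route_21181_of_corMinkowski xcTransport_holds hC

/-- ★★ the exponential conjecture K⁺ alone ⇒ 21181 BY NAME. -/
theorem route_21181_of_corMinkowskiExp' (hC : CorMinkowskiExpHard) :
    Summit.ValiantsHypothesis.ValiantsHypothesis.Theses.FifoMatching.NNDivisionHard :=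
  route_21181_of_corMinkowski' (corMinkowskiHard_of_exp hC)

/-! ## §9 THE PARKED INSTANCE `Q(Z_mix)` — typed (val-idea-crit-3 11:06:37Z CORRECTION 1; director R224 (α)).
crit-3's zonotope `Z_mix(n) := Σ_{k; l<m; k∉{l,m}} [−1,1]·(E^s_{kl} − E^s_{km})` (`E^s_{kl}` = the symmetric off-diagonal unit matrix;
`≈ n³/2` generators; `xc(Z_mix) ≤ 2·#generators ≤ n³`) inhabits the whole gap profile of the chamber certificate (laminar chambers:
A, A♯, B, C, D₀ all void) and defeats every STANDARD-COORDINATE face-exposure / common-maximiser recursion (faces containing a sub-cube copy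
`{b ⊇ A, b ∩ B = ∅}` of `COR(K_R)`: there `Z_mix(R)` rides along).  rev 3.1 parked the line at the then-open value `xc(COR(K_n) + Z_mix(n))`;
rev 4 (§10) DECIDES it at the route rate — `zmixCorHard_holds : ZmixCorHard` — by a gadget face hosting `COR(K_m)` on DIAGONAL slots, which the
rides-along argument does not cover (val-idea-crit-3 11:53:42Z: confirmed, «open instance» clause withdrawn).  The exponential rate
`ZmixCorExpHard` stays OPEN.  Typed here as a zonotope = convex hull of its `2^{#generators}` signed generator sums, so that it is literally an
instance of `CorMinkowskiHard` / `CorMinkowskiExpHard` (`zmixCorHard_of_corMinkowski`, `zmixCorExpHard_of_corMinkowskiExp`, PROVED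
specialisations). -/

/-- the symmetric off-diagonal unit matrix `E^s_{kl}` (as a function on index pairs). -/
def eSym (n : ℕ) (k l : Fin n) : Fin n × Fin n → ℝ :=
  fun p => if (p.1 = k ∧ p.2 = l) ∨ (p.1 = l ∧ p.2 = k) then 1 else 0

/-- generator directions of `Z_mix(n)`, indexed by all triples `(k, l, m)`; the direction is `E^s_{kl} − E^s_{km}` when `l < m` and
`k ∉ {l, m}`, and `0` otherwise (zero generators do not change the zonotope). -/
def zmixDir (n : ℕ) (g : Fin n × Fin n × Fin n) : Fin n × Fin n → ℝ :=
  if g.2.1 < g.2.2 ∧ g.1 ≠ g.2.1 ∧ g.1 ≠ g.2.2 then eSym n g.1 g.2.1 - eSym n g.1 g.2.2 else 0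

/-- the signed generator sums `Σ_g ε_g · D_g`, `ε ∈ {±1}^G` — the vertex candidates of the zonotope. -/
def zmixPt (n : ℕ) (ε : Fin n × Fin n × Fin n → Bool) : Fin n × Fin n → ℝ :=
  ∑ g, (if ε g then (1 : ℝ) else -1) • zmixDir n g

/-- **`Z_mix(n)`** = the zonotope `Σ_g [−1,1]·D_g` = `conv {Σ_g ε_g D_g : ε ∈ {±1}^G}`. -/
def Zmix (n : ℕ) : Set (Fin n × Fin n → ℝ) := convexHull ℝ (Set.range (zmixPt n))

/-- **Q(Z_mix), route (quasi-polynomial) rate**: `COR(K_n) + Z_mix(n)` has super-quasi-polynomial extension complexity.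
PROVED in §10 (`zmixCorHard_holds`, rate `2^{(⌊√n⌋−1)/2}`); the statement is kept verbatim from rev 3.1. -/
def ZmixCorHard : Prop :=
  ∀ c : ℕ, ∃ n₀ : ℕ, ∀ n ≥ n₀, ∀ r : ℕ, HasEFOfSize (corPolytopeGraph (⊤ : SimpleGraph (Fin n)) + Zmix n) r → T c n < r

/-- **Q(Z_mix), exponential rate**: `xc(COR(K_n) + Z_mix(n)) ≥ 2^{c·n}` eventually.  OPEN — NOT decided by §10 (whose certificate is capped
at `2^{Ω(√n)}` from the tree / `2^{Ω(n/log n)}` in print); it would follow from Göös–Jain–Watson's conjecture `xc(STAB(G_n)) ≥ 2^{Ω(n)}` for their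
bounded-degree family via the stable-set direction `C = −A_{G_n}` (paper).  The line's sharpest typed open point about `Z_mix`. -/
def ZmixCorExpHard : Prop :=
  ∃ c : ℝ, 0 < c ∧ ∃ n₀ : ℕ, ∀ n ≥ n₀, ∀ r : ℕ,
    HasEFOfSize (corPolytopeGraph (⊤ : SimpleGraph (Fin n)) + Zmix n) r → (2 : ℝ) ^ (c * n) ≤ r + 1

/-- `Q(Z_mix)` is literally an instance of COR-MINKOWSKI (route rate). -/
theorem zmixCorHard_of_corMinkowski (hK : CorMinkowskiHard) : ZmixCorHard := by
  intro c
  obtain ⟨n₀, hn₀⟩ := hK c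
  refine ⟨n₀, fun n hn r hr => ?_⟩
  obtain ⟨K, q, hq⟩ := exists_fin_range_eq (zmixPt n)
  exact hn₀ n hn K q r (by rw [hq]; exact hr)

/-- `Q(Z_mix)` at the exponential rate is an instance of K⁺. -/
theorem zmixCorExpHard_of_corMinkowskiExp (hK : CorMinkowskiExpHard) : ZmixCorExpHard := by
  obtain ⟨c, hc, n₀, hn₀⟩ := hK
  refine ⟨c, hc, n₀, fun n hn r hr => ?_⟩
  obtain ⟨K, q, hq⟩ := exists_fin_range_eq (zmixPt n)
  exact hn₀ n hn K q r (by rw [hq]; exact hr)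

/-! ## §10 `Q(Z_mix)` DECIDED AT THE ROUTE RATE (val-idea-7 g9): the exposed-face / diagonal-shadow certificate (PROP E)

MECHANISM.  (1) A support face of a Minkowski sum is the sum of the two support faces (`hasEFOfSize_face_add`, §2) and
linear images distribute (`hasEFOfSize_image_add`).  (2) `Z_mix(n)` lies in the OFF-DIAGONAL subspace `{x | ∀ i, x (i,i) = 0}`
(`zmix_diag`: its generators `E^s_{kl} − E^s_{km}`, `k ∉ {l,m}`, vanish on the diagonal), so any linear map reading only
diagonal coordinates sends every face of `Z_mix(n)` to `{0}` (`diagRead_image_zmix_face`).  (3) For an injective slot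
assignment `ι : Fin m ⊕ (Fin m × Fin m) ↪ Fin n` (vertex slots `u i`, pair slots `w (i,j)`) the AND-GADGET direction
`C = Σ_{(i,j)} (−E_{u_i u_j} + 2 E_{u_i w_ij} + 2 E_{u_j w_ij} − 3 E_{w_ij w_ij})` is valid on `COR(K_n)` with maximum `0`
(at the vertex `bbᵀ` its value is `−Σ pen(b_{u_i}, b_{u_j}, b_{w_ij})`, `pen(x,y,z) = xy − 2xz − 2yz + 3z ≥ 0` on `{0,1}³` with
`= 0` iff `z = xy`), and its face READ ON THE DIAGONAL SLOTS (`(u_i,u_i)` for `i = j`, `(w_ij, w_ij)` for `i ≠ j`) is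
exactly `COR(K_m)` (`diagRead_image_cor_face`).  Hence ★ `hasEFOfSize_cor_of_cor_add_zmix`:
`HasEFOfSize (COR(K_n) + Z_mix(n)) r → HasEFOfSize (COR(K_m)) r` whenever `m + m² ≤ n`; Kaibel–Weltge
(`corPolytopeGraph_top_two_pow_half_le`, tree) gives `2^{m/2} ≤ r` (`two_pow_le_of_cor_add_zmix`), and with `m = ⌊√n⌋ − 1`,
`T_pow_four_le` (§8) and c1's `growth_eventually`: ★★ `zmixCorHard_holds : ZmixCorHard` — 0 sorry, 0 new facts.
NOT DECIDED HERE: `ZmixCorExpHard` (rate `2^{c·n}`).  This certificate yields `2^{(⌊√n⌋−1)/2}` from the tree; the same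
mechanism with the stable-set direction `C = −A_G` exposes `STAB(G)` on the diagonal, so print gives `2^{Ω(n / log n)}`
(Göös–Jain–Watson, SIAM J. Comput. 47 (2018), extension complexity of independent-set polytopes) — not in the tree, not used.
WHAT IT MEANS FOR THE LAW (card rev 4): PROP E is a second certificate family beside the chamber certificate (PROP A–D₀):
every purely off-diagonal passenger — `Z_mix` included — is killed by exposing a gadget face of `COR` and reading the
diagonal; a counterexample to COR-MINKOWSKI must put DIAGONAL mass on every exposed gadget face.  COR-MINKOWSKI `∀ Q`
(`CorMinkowskiHard`) stays OPEN; stmt-21181 `NNDivisionHard` stays OPEN; nothing here is a statement about VP ≠ VNP. -/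

/-! ### §10a `Z_mix(n)` is off-diagonal -/

theorem eSym_diag {n : ℕ} {k l : Fin n} (hkl : k ≠ l) (i : Fin n) : eSym n k l (i, i) = 0 := by
  simp only [eSym]
  rw [if_neg]
  rintro (⟨h1, h2⟩ | ⟨h1, h2⟩)
  · exact hkl (h1.symm.trans h2)
  · exact hkl (h2.symm.trans h1)

theorem zmixDir_diag (n : ℕ) (g : Fin n × Fin n × Fin n) (i : Fin n) : zmixDir n g (i, i) = 0 := by
  unfold zmixDir
  split_ifs with h
  · rw [Pi.sub_apply, eSym_diag h.2.1 i, eSym_diag h.2.2 i, sub_zero]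
  · rfl

theorem zmixPt_diag (n : ℕ) (ε : Fin n × Fin n × Fin n → Bool) (i : Fin n) : zmixPt n ε (i, i) = 0 := by
  unfold zmixPt
  rw [Finset.sum_apply]
  exact Finset.sum_eq_zero fun g _ => by rw [Pi.smul_apply, zmixDir_diag, smul_zero]

/-- every point of `Z_mix(n)` has zero diagonal. -/
theorem zmix_diag {n : ℕ} {z : Fin n × Fin n → ℝ} (hz : z ∈ Zmix n) (i : Fin n) : z (i, i) = 0 := by
  have h1 := dot_le_of_mem_convexHull (Set.range (zmixPt n)) (Pi.single (i, i) 1) 0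
    (by rintro _ ⟨ε, rfl⟩; rw [single_dotProduct, one_mul, zmixPt_diag]) z hz
  have h2 := dot_le_of_mem_convexHull (Set.range (zmixPt n)) (-Pi.single (i, i) 1) 0
    (by rintro _ ⟨ε, rfl⟩; rw [neg_dotProduct, single_dotProduct, one_mul, zmixPt_diag, neg_zero]) z hz
  rw [neg_dotProduct, single_dotProduct, one_mul] at h2
  rw [single_dotProduct, one_mul] at h1
  linarith

/-! ### §10b The AND-gadget direction and the diagonal read -/

section Gadget

open Literature.Combinatorics.Optimization (corVec corVec_apply_diag corVec_apply_adj)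

variable {m n : ℕ}

/-- vertex slot `u i`. -/
def uSlot (ι : Fin m ⊕ (Fin m × Fin m) ↪ Fin n) (i : Fin m) : Fin n := ι (Sum.inl i)

/-- pair slot `w (i, j)`. -/
def wSlot (ι : Fin m ⊕ (Fin m × Fin m) ↪ Fin n) (g : Fin m × Fin m) : Fin n := ι (Sum.inr g)

/-- the elementary functional `E_{pq}`: `E_{pq} · x = x (p, q)`. -/
def eFun (n : ℕ) (p q : Fin n) : Fin n × Fin n → ℝ := Pi.single (p, q) 1

theorem eFun_dot (p q : Fin n) (x : Fin n × Fin n → ℝ) : eFun n p q ⬝ᵥ x = x (p, q) := by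
  rw [eFun, single_dotProduct, one_mul]

/-- the AND-gadget functional of the pair `g = (i, j)`: `−E_{u_i u_j} + 2E_{u_i w_g} + 2E_{u_j w_g} − 3E_{w_g w_g}`. -/
def gadFun (ι : Fin m ⊕ (Fin m × Fin m) ↪ Fin n) (g : Fin m × Fin m) : Fin n × Fin n → ℝ :=
  -eFun n (uSlot ι g.1) (uSlot ι g.2) + (2 : ℝ) • eFun n (uSlot ι g.1) (wSlot ι g)
    + (2 : ℝ) • eFun n (uSlot ι g.2) (wSlot ι g) - (3 : ℝ) • eFun n (wSlot ι g) (wSlot ι g)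

theorem gadFun_dot (ι : Fin m ⊕ (Fin m × Fin m) ↪ Fin n) (g : Fin m × Fin m) (x : Fin n × Fin n → ℝ) :
    gadFun ι g ⬝ᵥ x = -x (uSlot ι g.1, uSlot ι g.2) + 2 * x (uSlot ι g.1, wSlot ι g)
      + 2 * x (uSlot ι g.2, wSlot ι g) - 3 * x (wSlot ι g, wSlot ι g) := by
  simp only [gadFun, add_dotProduct, sub_dotProduct, neg_dotProduct, smul_dotProduct, smul_eq_mul, eFun_dot]

/-- **the AND-gadget direction** `C = Σ_g gadFun g`. -/
def andDir (ι : Fin m ⊕ (Fin m × Fin m) ↪ Fin n) : Fin n × Fin n → ℝ := ∑ g, gadFun ι g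

theorem andDir_dot (ι : Fin m ⊕ (Fin m × Fin m) ↪ Fin n) (x : Fin n × Fin n → ℝ) :
    andDir ι ⬝ᵥ x = ∑ g, gadFun ι g ⬝ᵥ x := by
  rw [andDir, sum_dotProduct]

/-- entries of `corVec ⊤ b` (diagonal included): `[b p] · [b q]`. -/
theorem corVec_top_apply (b : Fin n → Bool) (p q : Fin n) :
    corVec (⊤ : SimpleGraph (Fin n)) b (p, q) = (if b p then 1 else 0) * (if b q then 1 else 0) := by
  by_cases hpq : p = q
  · subst hpq
    rw [corVec_apply_diag]
    cases hb : b p <;> simp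
  · rw [corVec_apply_adj _ _ ((SimpleGraph.top_adj p q).2 hpq)]
    cases hb : b p <;> cases hb' : b q <;> simp

/-- the Boolean penalty `pen(x,y,z) = xy − 2xz − 2yz + 3z`. -/
def pen (x y z : Bool) : ℝ :=
  (if x then 1 else 0) * (if y then 1 else 0) - 2 * ((if x then 1 else 0) * (if z then 1 else 0))
    - 2 * ((if y then 1 else 0) * (if z then 1 else 0)) + 3 * (if z then 1 else 0)

theorem pen_nonneg (x y z : Bool) : 0 ≤ pen x y z := by
  cases x <;> cases y <;> cases z <;> norm_num [pen]

theorem pen_eq_zero_iff (x y z : Bool) : pen x y z = 0 ↔ z = (x && y) := by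
  cases x <;> cases y <;> cases z <;> norm_num [pen]

theorem gadFun_dot_corVec (ι : Fin m ⊕ (Fin m × Fin m) ↪ Fin n) (g : Fin m × Fin m) (b : Fin n → Bool) :
    gadFun ι g ⬝ᵥ corVec ⊤ b = -pen (b (uSlot ι g.1)) (b (uSlot ι g.2)) (b (wSlot ι g)) := by
  rw [gadFun_dot, corVec_top_apply, corVec_top_apply, corVec_top_apply, corVec_top_apply, pen]
  have hw : (if b (wSlot ι g) then (1 : ℝ) else 0) * (if b (wSlot ι g) then 1 else 0) =
      if b (wSlot ι g) then 1 else 0 := by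
    cases hb : b (wSlot ι g) <;> simp
  rw [hw]; ring

theorem andDir_dot_corVec (ι : Fin m ⊕ (Fin m × Fin m) ↪ Fin n) (b : Fin n → Bool) :
    andDir ι ⬝ᵥ corVec ⊤ b = -∑ g, pen (b (uSlot ι g.1)) (b (uSlot ι g.2)) (b (wSlot ι g)) := by
  rw [andDir_dot, ← Finset.sum_neg_distrib]
  exact Finset.sum_congr rfl fun g _ => gadFun_dot_corVec ι g b

theorem andDir_dot_corVec_le (ι : Fin m ⊕ (Fin m × Fin m) ↪ Fin n) (b : Fin n → Bool) :
    andDir ι ⬝ᵥ corVec ⊤ b ≤ 0 := by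
  rw [andDir_dot_corVec, neg_nonpos]
  exact Finset.sum_nonneg fun g _ => pen_nonneg _ _ _

/-- `C · x ≤ 0` is VALID on `COR(K_n)`. -/
theorem andDir_valid (ι : Fin m ⊕ (Fin m × Fin m) ↪ Fin n) :
    ∀ x ∈ corPolytopeGraph (⊤ : SimpleGraph (Fin n)), andDir ι ⬝ᵥ x ≤ 0 :=
  dot_le_of_mem_convexHull _ _ _ (by rintro _ ⟨b, rfl⟩; exact andDir_dot_corVec_le ι b)

/-- tight vertices are gadget-consistent: `b_{w_ij} = b_{u_i} ∧ b_{u_j}`. -/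
theorem consistent_of_andDir_dot_eq_zero (ι : Fin m ⊕ (Fin m × Fin m) ↪ Fin n) {b : Fin n → Bool}
    (h : andDir ι ⬝ᵥ corVec ⊤ b = 0) (g : Fin m × Fin m) :
    b (wSlot ι g) = (b (uSlot ι g.1) && b (uSlot ι g.2)) := by
  rw [andDir_dot_corVec, neg_eq_zero, Finset.sum_eq_zero_iff_of_nonneg (fun g _ => pen_nonneg _ _ _)] at h
  exact (pen_eq_zero_iff _ _ _).1 (h g (Finset.mem_univ g))

/-- slot values of `b' ∈ {0,1}^m`: `b'_i` at the vertex slot `i`, `b'_i b'_j` at the pair slot `(i, j)`. -/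
def slotVal (b' : Fin m → Bool) : Fin m ⊕ (Fin m × Fin m) → Bool :=
  Sum.elim b' fun g => b' g.1 && b' g.2

open Classical in
/-- the lift of `b' ∈ {0,1}^m` to `{0,1}^n` (slots get their values, unused positions `false`). -/
def liftBool (ι : Fin m ⊕ (Fin m × Fin m) ↪ Fin n) (b' : Fin m → Bool) : Fin n → Bool :=
  fun p => decide (∃ s, ι s = p ∧ slotVal b' s = true)

theorem liftBool_apply (ι : Fin m ⊕ (Fin m × Fin m) ↪ Fin n) (b' : Fin m → Bool)
    (s : Fin m ⊕ (Fin m × Fin m)) : liftBool ι b' (ι s) = slotVal b' s := by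
  unfold liftBool
  cases hs : slotVal b' s
  · rw [decide_eq_false_iff_not]
    rintro ⟨s', h1, h2⟩
    rw [ι.injective h1, hs] at h2
    exact Bool.false_ne_true h2
  · exact decide_eq_true ⟨s, rfl, hs⟩

theorem liftBool_wSlot (ι : Fin m ⊕ (Fin m × Fin m) ↪ Fin n) (b' : Fin m → Bool) (g : Fin m × Fin m) :
    liftBool ι b' (wSlot ι g) = (liftBool ι b' (uSlot ι g.1) && liftBool ι b' (uSlot ι g.2)) := by
  simp only [wSlot, uSlot, liftBool_apply]; rfl

theorem andDir_dot_corVec_liftBool (ι : Fin m ⊕ (Fin m × Fin m) ↪ Fin n) (b' : Fin m → Bool) :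
    andDir ι ⬝ᵥ corVec ⊤ (liftBool ι b') = 0 := by
  rw [andDir_dot_corVec, neg_eq_zero]
  exact Finset.sum_eq_zero fun g _ => (pen_eq_zero_iff _ _ _).2 (liftBool_wSlot ι b' g)

/-- the DIAGONAL position read for the coordinate `(i, j)` of `ℝ^{m×m}`: `(u_i, u_i)` if `i = j`, else `(w_ij, w_ij)`. -/
def slotPos (ι : Fin m ⊕ (Fin m × Fin m) ↪ Fin n) : Fin m × Fin m → Fin n × Fin n
  | (i, j) => if i = j then (uSlot ι i, uSlot ι i) else (wSlot ι (i, j), wSlot ι (i, j))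

theorem slotPos_diag (ι : Fin m ⊕ (Fin m × Fin m) ↪ Fin n) (g : Fin m × Fin m) : ∃ p, slotPos ι g = (p, p) := by
  obtain ⟨i, j⟩ := g
  rw [slotPos]
  split_ifs <;> exact ⟨_, rfl⟩

/-- **the diagonal read** `ℝ^{n×n} → ℝ^{m×m}`, `x ↦ (x (slotPos (i,j)))_{(i,j)}` — a coordinate projection. -/
def diagRead (ι : Fin m ⊕ (Fin m × Fin m) ↪ Fin n) : (Fin n × Fin n → ℝ) →ₗ[ℝ] (Fin m × Fin m → ℝ) :=
  LinearMap.funLeft ℝ ℝ (slotPos ι)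

theorem diagRead_apply (ι : Fin m ⊕ (Fin m × Fin m) ↪ Fin n) (x : Fin n × Fin n → ℝ) (g : Fin m × Fin m) :
    diagRead ι x g = x (slotPos ι g) := rfl

/-- the diagonal read kills `Z_mix(n)`. -/
theorem diagRead_zmix (ι : Fin m ⊕ (Fin m × Fin m) ↪ Fin n) {z : Fin n × Fin n → ℝ} (hz : z ∈ Zmix n) :
    diagRead ι z = 0 := by
  funext g
  obtain ⟨p, hp⟩ := slotPos_diag ι g
  rw [diagRead_apply, hp, zmix_diag hz]; rfl

/-- the diagonal read of a gadget-consistent vertex of `COR(K_n)` is the vertex of `COR(K_m)` of its vertex-slot values. -/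
theorem diagRead_corVec (ι : Fin m ⊕ (Fin m × Fin m) ↪ Fin n) {b : Fin n → Bool}
    (hb : ∀ g : Fin m × Fin m, b (wSlot ι g) = (b (uSlot ι g.1) && b (uSlot ι g.2))) :
    diagRead ι (corVec ⊤ b) = corVec (⊤ : SimpleGraph (Fin m)) (fun i => b (uSlot ι i)) := by
  funext g
  obtain ⟨i, j⟩ := g
  rw [diagRead_apply, slotPos]
  by_cases hij : i = j
  · subst hij
    rw [if_pos rfl, corVec_apply_diag, corVec_apply_diag]
  · rw [if_neg hij, corVec_apply_diag, corVec_apply_adj _ _ ((SimpleGraph.top_adj i j).2 hij), hb (i, j)]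

/-- ★ **CLAIM A — the gadget face of `COR(K_n)` read on the diagonal IS `COR(K_m)`.** -/
theorem diagRead_image_cor_face (ι : Fin m ⊕ (Fin m × Fin m) ↪ Fin n) :
    diagRead ι '' (corPolytopeGraph (⊤ : SimpleGraph (Fin n)) ∩ {x | andDir ι ⬝ᵥ x = 0}) =
      corPolytopeGraph (⊤ : SimpleGraph (Fin m)) := by
  unfold corPolytopeGraph
  rw [convexHull_range_inter_eq _ (andDir ι) 0 (andDir_dot_corVec_le ι), LinearMap.image_convexHull,
    ← Set.range_comp]
  congr 1
  ext y
  constructor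
  · rintro ⟨⟨b, hb⟩, rfl⟩
    exact ⟨fun i => b (uSlot ι i), (diagRead_corVec ι (consistent_of_andDir_dot_eq_zero ι hb)).symm⟩
  · rintro ⟨b', rfl⟩
    refine ⟨⟨liftBool ι b', andDir_dot_corVec_liftBool ι b'⟩, ?_⟩
    show diagRead ι (corVec ⊤ (liftBool ι b')) = corVec ⊤ b'
    rw [diagRead_corVec ι (fun g => liftBool_wSlot ι b' g)]
    congr 1
    funext i
    exact liftBool_apply ι b' (Sum.inl i)

/-- the sign pattern maximising a functional `C` over the generators of `Z_mix(n)`. -/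
def zmixArgmax (C : Fin n × Fin n → ℝ) : Fin n × Fin n × Fin n → Bool :=
  fun g => decide (0 ≤ C ⬝ᵥ zmixDir n g)

theorem dot_zmixPt (C : Fin n × Fin n → ℝ) (ε : Fin n × Fin n × Fin n → Bool) :
    C ⬝ᵥ zmixPt n ε = ∑ g, (if ε g then (1 : ℝ) else -1) * (C ⬝ᵥ zmixDir n g) := by
  unfold zmixPt
  rw [dotProduct_sum]
  exact Finset.sum_congr rfl fun g _ => by rw [dotProduct_smul, smul_eq_mul]

theorem dot_zmixPt_le (C : Fin n × Fin n → ℝ) (ε : Fin n × Fin n × Fin n → Bool) :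
    C ⬝ᵥ zmixPt n ε ≤ C ⬝ᵥ zmixPt n (zmixArgmax C) := by
  rw [dot_zmixPt, dot_zmixPt]
  refine Finset.sum_le_sum fun g _ => ?_
  have key : (if zmixArgmax C g then (1 : ℝ) else -1) * (C ⬝ᵥ zmixDir n g) = |C ⬝ᵥ zmixDir n g| := by
    unfold zmixArgmax
    by_cases h : 0 ≤ C ⬝ᵥ zmixDir n g
    · rw [abs_of_nonneg h]; simp [h]
    · rw [abs_of_neg (not_le.1 h)]; simp [h]
  rw [key]
  split_ifs
  · rw [one_mul]; exact le_abs_self _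
  · rw [neg_one_mul]; exact neg_le_abs _

/-- `C · y ≤ C · zmixPt (argmax)` is VALID on `Z_mix(n)` (and tight at a generator sum, so the face is nonempty). -/
theorem valid_zmix (C : Fin n × Fin n → ℝ) : ∀ y ∈ Zmix n, C ⬝ᵥ y ≤ C ⬝ᵥ zmixPt n (zmixArgmax C) :=
  dot_le_of_mem_convexHull _ _ _ (by rintro _ ⟨ε, rfl⟩; exact dot_zmixPt_le C ε)

/-- ★ **CLAIM B — every support face of `Z_mix(n)` reads as `{0}` on the diagonal.** -/
theorem diagRead_image_zmix_face (ι : Fin m ⊕ (Fin m × Fin m) ↪ Fin n) (C : Fin n × Fin n → ℝ) :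
    diagRead ι '' (Zmix n ∩ {y | C ⬝ᵥ y = C ⬝ᵥ zmixPt n (zmixArgmax C)}) = {0} := by
  refine Set.eq_singleton_iff_unique_mem.2 ⟨?_, ?_⟩
  · have hmem : zmixPt n (zmixArgmax C) ∈ Zmix n := subset_convexHull ℝ _ ⟨_, rfl⟩
    exact ⟨zmixPt n (zmixArgmax C), ⟨hmem, rfl⟩, diagRead_zmix ι hmem⟩
  · rintro _ ⟨y, ⟨hy, -⟩, rfl⟩
    exact diagRead_zmix ι hy

/-- ★★ **PROP E — the exposed-face / diagonal-shadow certificate**: an extended formulation of `COR(K_n) + Z_mix(n)` is one,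
of the same size, of `COR(K_m)`, for every injective slot assignment `Fin m ⊕ (Fin m × Fin m) ↪ Fin n`. -/
theorem hasEFOfSize_cor_of_cor_add_zmix_emb (ι : Fin m ⊕ (Fin m × Fin m) ↪ Fin n) {r : ℕ}
    (h : HasEFOfSize (corPolytopeGraph (⊤ : SimpleGraph (Fin n)) + Zmix n) r) :
    HasEFOfSize (corPolytopeGraph (⊤ : SimpleGraph (Fin m))) r := by
  have h1 := hasEFOfSize_image_add
    (hasEFOfSize_face_add h (andDir ι) 0 (andDir ι ⬝ᵥ zmixPt n (zmixArgmax (andDir ι)))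
      (andDir_valid ι) (valid_zmix (andDir ι))) (diagRead ι)
  rwa [diagRead_image_cor_face, diagRead_image_zmix_face, Set.singleton_zero, add_zero] at h1

end Gadget

/-- ★★ `HasEFOfSize (COR(K_n) + Z_mix(n)) r → HasEFOfSize (COR(K_m)) r` whenever `m + m² ≤ n`. -/
theorem hasEFOfSize_cor_of_cor_add_zmix {m n r : ℕ} (hmn : m + m * m ≤ n)
    (h : HasEFOfSize (corPolytopeGraph (⊤ : SimpleGraph (Fin n)) + Zmix n) r) :
    HasEFOfSize (corPolytopeGraph (⊤ : SimpleGraph (Fin m))) r := by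
  have hne : Nonempty (Fin m ⊕ (Fin m × Fin m) ↪ Fin n) := by
    rw [Function.Embedding.nonempty_iff_card_le]
    simpa using hmn
  exact hasEFOfSize_cor_of_cor_add_zmix_emb hne.some h

/-- ★★ **`xc(COR(K_n) + Z_mix(n)) ≥ 2^{m/2}`** for every `m ≥ 4` with `m + m² ≤ n` (PROP E + Kaibel–Weltge). -/
theorem two_pow_le_of_cor_add_zmix {m n r : ℕ} (hm : 4 ≤ m) (hmn : m + m * m ≤ n)
    (h : HasEFOfSize (corPolytopeGraph (⊤ : SimpleGraph (Fin n)) + Zmix n) r) :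
    (2 : ℝ) ^ ((m : ℝ) / 2) ≤ r :=
  Literature.Barriers.PneNP.corPolytopeGraph_top_two_pow_half_le hm (hasEFOfSize_cor_of_cor_add_zmix hmn h)

open Summit.ValiantsHypothesis.ValiantsHypothesis.Theorems.FifoMatching.QueueGridFace (growth_eventually) in
/-- ★★★ **`Q(Z_mix)` IS DECIDED AT THE ROUTE RATE: `ZmixCorHard` holds** — `xc(COR(K_n) + Z_mix(n)) > T c n` eventually, for
every `c` (`2^{(⌊√n⌋−1)/2} ≤ r` by `two_pow_le_of_cor_add_zmix` with `m = ⌊√n⌋ − 1`; `T c n ≤ (T c n)⁴ ≤ T c' m` by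
`T_pow_four_le` since `n < m⁴`; `T c' m < 2^{m/4}` eventually by c1's `growth_eventually`).  The parked instance of the card's
open problem is thereby settled in the direction the LAW predicts; `CorMinkowskiHard` itself (all passengers) stays OPEN. -/
theorem zmixCorHard_holds : ZmixCorHard := by
  intro c
  obtain ⟨r₀, hr₀2, hgrowth⟩ := growth_eventually (4 ^ (c + 1) + c + 1) (c := (1 / 2 : ℝ)) (by norm_num)
  refine ⟨(max r₀ 4 + 2) ^ 2, fun n hn r hEF => ?_⟩
  -- `s = ⌊√n⌋`, `m = s - 1`
  obtain ⟨s, hs⟩ : ∃ s, s = Nat.sqrt n := ⟨_, rfl⟩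
  have hsR : max r₀ 4 + 2 ≤ s := by rw [hs]; exact Nat.le_sqrt'.2 hn
  have hss : s * s ≤ n := by rw [hs]; exact Nat.sqrt_le n
  have hns : n < (s + 1) * (s + 1) := by rw [hs]; exact Nat.lt_succ_sqrt n
  obtain ⟨m, hm⟩ : ∃ m, m = s - 1 := ⟨_, rfl⟩
  have hm1 : s = m + 1 := by omega
  have hm4 : 4 ≤ m := by
    have := le_max_right r₀ 4
    omega
  have hmr : r₀ ≤ m := by
    have := le_max_left r₀ 4
    omega
  rw [hm1] at hss hns
  have hmn : m + m * m ≤ n := by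
    have : m + m * m ≤ (m + 1) * (m + 1) := by nlinarith
    omega
  have h16 : 4 * 4 ≤ m * m := Nat.mul_le_mul hm4 hm4
  have hsm : (m + 1 + 1) * (m + 1 + 1) ≤ m ^ 4 :=
    calc (m + 1 + 1) * (m + 1 + 1) = (m + 2) * (m + 2) := by ring
      _ ≤ (4 * m) * (4 * m) := Nat.mul_le_mul (by omega) (by omega)
      _ = 16 * (m * m) := by ring
      _ ≤ (m * m) * (m * m) := Nat.mul_le_mul_right _ h16
      _ = m ^ 4 := by ring
  have hn4 : n < m ^ 4 := lt_of_lt_of_le hns hsm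
  have hn0 : n ≠ 0 := by omega
  have hT := T_pow_four_le (c := c) hn0 hn4
  have hbound := two_pow_le_of_cor_add_zmix hm4 hmn hEF
  have hg := hgrowth m hmr
  have hmono : (2 : ℝ) ^ ((1 / 2 : ℝ) * ((m / 2 : ℕ) : ℝ)) ≤ (2 : ℝ) ^ ((m : ℝ) / 2) := by
    apply Real.rpow_le_rpow_of_exponent_le (by norm_num)
    have : ((m / 2 : ℕ) : ℝ) ≤ (m : ℝ) := by exact_mod_cast Nat.div_le_self m 2
    linarith
  have hT' : ((T (4 ^ (c + 1) + c + 1) m : ℕ) : ℝ) =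
      (2 : ℝ) ^ ((Nat.log 2 m + (4 ^ (c + 1) + c + 1)) ^ (4 ^ (c + 1) + c + 1)) := by
    simp [T]
  have hpos : (0 : ℝ) ≤ 4 * (m : ℝ) ^ 4 := by positivity
  have hlt : ((T (4 ^ (c + 1) + c + 1) m : ℕ) : ℝ) < r := by rw [hT']; linarith
  have hlt' : T (4 ^ (c + 1) + c + 1) m < r := by exact_mod_cast hlt
  calc T c n ≤ (T c n) ^ 4 := Nat.le_self_pow (by norm_num) _
    _ ≤ T (4 ^ (c + 1) + c + 1) m := hT
    _ < r := hlt'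

/-- the same, as the explicit lower bound `xc(COR(K_n) + Z_mix(n)) ≥ 2^{(⌊√n⌋ − 1)/2}` for `⌊√n⌋ ≥ 5`. -/
theorem two_pow_sqrt_le_of_cor_add_zmix {n r : ℕ} (hn : 5 ≤ Nat.sqrt n)
    (h : HasEFOfSize (corPolytopeGraph (⊤ : SimpleGraph (Fin n)) + Zmix n) r) :
    (2 : ℝ) ^ (((Nat.sqrt n - 1 : ℕ) : ℝ) / 2) ≤ r := by
  refine two_pow_le_of_cor_add_zmix (m := Nat.sqrt n - 1) (by omega) ?_ h
  have hss : Nat.sqrt n * Nat.sqrt n ≤ n := Nat.sqrt_le n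
  obtain ⟨m, hm⟩ : ∃ m, m = Nat.sqrt n - 1 := ⟨_, rfl⟩
  have hm1 : Nat.sqrt n = m + 1 := by omega
  rw [← hm]; rw [hm1] at hss
  have : m + m * m ≤ (m + 1) * (m + 1) := by nlinarith
  omega

end Summit.ValiantsHypothesis.ValiantsHypothesis.Cruxes.NNLinearDegreeCofactorHard.XcDivision

end
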